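/-
Copyright: statement-level skeleton of a published paper (lit-balaban cell, Phase-2 proof seat p31, gen 24). No proof claims beyond what the
kernel checks below.
-/
import Literature.MathematicalPhysics.QuantumFieldTheory.BalabanImbrieJaffe1984to88.BIJ88Ineq246Lattice
import Literature.MathematicalPhysics.QuantumFieldTheory.BalabanImbrieJaffe1984to88.BIJ85Ineq723TorusCornerGauge
import Literature.MathematicalPhysics.QuantumFieldTheory.Balaban1983to89.B6Cov2156TorusSubset

/-!
# `BalabanImbrieJaffe1984to88.BIJ88Eq249GaugeCovarianceTorus` — T. Bałaban, J. Imbrie, A. Jaffe, *Effective action and cluster properties of the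
abelian Higgs model*, Commun. Math. Phys. **114** (1988) 257–315 [BalabanImbrieJaffe1988], §2 p. 265 [PDF 9], **(2.49): THE RANDOM WALK EXPANSION
OF THE SINGLE-STEP COVARIANCE FOR THE GAUGE FIELD, `C^{(k)}_Λ = C^{(k)}_{Λ,loc} + Σ_X C^{(k)}_{Λ,X}`, "WITH SIMILAR ESTIMATES", FOR THE GAUGE-FIELD
COVARIANCE OF RECORD** — the covariance `C^{(k)}_Λ = C_Λ(C_Λ*Δ_kC_Λ)⁻¹C_Λ*` of T. Bałaban, *Propagators and renormalization transformations for lattice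
gauge theories. II*, Commun. Math. Phys. **96** (1984) 223–250 [Balaban1984PropagatorsII] (2.152)–(2.156) (the object the print cites for the gauge
field: [BalabanImbrieJaffe1985] p. 311 *"The actions Δ_k and propagators C^{(k)} were studied by Balaban [6II]"*), with the GENUINE action `Δ_k` of
[Balaban1984PropagatorsI] (1.65) = [BalabanImbrieJaffe1985] (4.3.1) on the tori of the series (p09's bridge `BIJ85Eq431DeltaKBridge` /
`BIJ85Ineq723TorusCornerGauge.DeltaK_eq_submatrix`), for regions `Λ = B(Λ′₀)` of the unit lattice `T₁^{(k)}` in half-torus position.  The [6] =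
[Balaban1983RegularityDecay] Sect. 5 operator `A` of this covariance is IDENTIFIED (`opA` = the reduced operator `C_Λ*Δ_kC_Λ` padded to the bond variables
of the torus box, a `B4.Idx`-operator on `ℤ^d` with `N = d`), ITS (5.6) IS PROVED (`hyp56_opA`: the (2.153)/(2.157) lower bound + *"C is a
short-ranged operator, so C\*Δ_kC has the same exponential decay as Δ_k"* in the torus distance + half-torus position), and p13's `ℤ^d` walk files are
applied BY NAME (`eq242_lattice`, `eq245_lattice`, `abs_inv_lattice_le`, `abs_cLoc_lattice_le`, `abs_cX_lattice_le`, `abs_cLoc_sub_inv_le`,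
`close247_lattice`, `cX_support`/`latticeCw_support`), then sandwiched back by `C_Λ(·)C_Λᵀ` (2.156).  r18's audit `AUDIT-C2S14-DEF-g26.md` row C2.Eq2.49:
«the identification of [6]'s operator A with the GAUGE-FIELD covariance of (2.48) … is NOT made — MEMBER OWED: walk expansion of the gauge-field
covariance: (5.6) for it + `eq245_lattice` BY NAME» — made here.

statement-level skeleton of published theorems with citation tags; proofs where landed; nothing here is a claim about the Yang–Mills mass gap

PDF held: `paper:balaban1988-cmp114-bij-abelian-higgs-effective-action` (journal page = PDF page + 256; p. 265 = PDF 9 re-read this session, `lit read …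
--pages 8-10`); `paper:balaban1984-cmp96-propagators-rt-ii` (journal page = PDF page + 222; p. 250 = PDF 28, `lit read … --pages 27-28 --grep 2.156`);
`paper:balaban1985-cmp97-bij-higgs-minimizers` (journal page = PDF page + 298; p. 311 = PDF 13, `--grep 4.3.3`).

CITATION HEADER (lean-in-tree rule).  lit-balaban cell (HOME `run/shared/lean/pub/lit-balaban/`), Phase 2, proof seat **p31 gen 24** (unit `lit-balaban-p31`,
literature-prover-lit-balaban-p31-g24-0), free-target protocol G.5-34(d), TAKING #1 line HOME/STATUS.md 2026-08-23T12:07Z (window 20 min; stem check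
`249|GaugeCovariance` = p13's `BIJ88WalkGaugeCovariance` only (the p. 265 gauge-COVARIANCE sentence, unrelated); cc r18, p13, p09, pub-balaban pv09).  Row of
`HOME/lit-balaban-r18/ROWS-C2.md` served: **C2.Eq2.49** (owner r18, KEEP row of `AUDIT-C2S14-DEF-g26.md`; decl of record `BIJ88Sect2Statements.Eq245`, ℤ^d
operator-model instance p13's `BIJ88Eq242Lattice.eq245_lattice`) — LOCATED MEMBER «for the gauge-field covariance of record»; also touches **C2.Eq2.41 /
2.42 / 2.46 / 2.47** (gauge-field analogs, "similar estimates"), **C1.Eq4.3.3 / C1.Eq4.3.4-4.3.5 / C1.Eq7.2.3** (owner r15; the Λ-covariance of the (4.3.1)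
action, decay on sub-regions by the walk route) and **B6.Eq2.152–2.157** (owner r03; pv09's objects consumed).  Files USED BY NAME, nothing restated: p13
`BIJ88Eq242Lattice` (`latticeCw`, `eq242_lattice`, `eq245_lattice`), `BIJ88Ineq246Lattice` (`ldist`, `sdist`, `cubeOf`, `touch`, `Cubes`, `K0`, `thetaW`,
`abs_inv_lattice_le`, `abs_cLoc_lattice_le`, `abs_cX_lattice_le`, `abs_cLoc_sub_inv_le`, `close247_lattice`, `latticeCw_support`), `BIJ88RandomWalk242`
(`Walk`, `cLoc`, `cX`, `memX`, `cX_support`, `subset_closure`), `B4Sect5CubeBounds` (`labels`, `kR`, `thetaConst`, `InBox`), r18/p02 `BIJ88Sect2Statements`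
(`Eq245`, `Ineq246`, `Close`); pub-balaban pv09 `B6BondElimination` (`pad`, `pad_inv`, `pad_coe`, `hyp56_pad`, `isUnit_det_of_lower`, `SubReduction.cov`),
`B6BondEliminationTorus` (`pdist`, `pdist_le_dist`, `zdPer`, `ofPer`, `FrameSubReduction.Printed`, `circAbs_res`), `B6FrameReduction` (`Frame`, `Frame.pms`),
`B6FromB4` (`sandwich_decay`, `sandwich_lowerBound`, `sandwich_isSymm`), `B6Cov2156Torus` (`elimT_range`, `one_le_M`, `LowerOnConstrainedT`),
`B6Cov2156TorusSubset` (`lamFree`, `elimLam`, `bondReductionLam`, `subFamilyT_printedPer`, `elimTS_row`, `IsLam`, `mem_lamFree`), `B6Cov2156TorusDelK`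
(`reDelK`, `reDelK_isSymm`, `kernelDecay_reDelK`, `lowerOnConstrainedT_reDelK_sharp`, `gamma2153one`), `B4Sect5Torus` (`tdist_*`, `circAbs_le_tdist`),
`B4TorusKernel.MultiPeriod.circAbs_of_centred`; p09 `BIJ85Ineq723TorusCornerGauge` (`idx`, `idx_fst_coe`, `L_dvd_Mk`), `BIJ85Eq431DeltaKBridge`
(`one_le_Lpow`, `pdist_rep_eq_supDist`).

## The print (verbatim)

[BalabanImbrieJaffe1988] p. 265 [PDF 9]: *"Note that all operators introduced through random walk expansions of C^{(k)}_Λ(u) or G_Λ(Ω, u) transform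
properly under gauge transformations … Lastly we note that the single-step covariance for the gauge field can be given a random walk expansion analogous to
(2.45), with similar estimates: C^{(k)}_Λ = C^{(k)}_{Λ,loc} + Σ_X C^{(k)}_{Λ,X}. (2.49)"*; p. 264 [PDF 8] (the model (2.45)): *"C^{(k)}_Λ(u) =
C^{(k)}_{Λ,loc}(u) + Σ_X C^{(k)}_{Λ,X}(u), (2.45) and the convergence and locality properties of the random walk expansion imply the following facts about
these operators. The local part … is bounded as in (2.41). The operator C^{(k)}_{Λ,X}(u) … vanishes unless both arguments are in X, and is estimated as
follows: |C^{(k)}_{Λ,X}(u; x₁, x₂)| ≦ e^{−cr(e_k)|X|}. (2.46) … |C^{(k)}_{Λ,loc}(u; x₁, x₂) − C^{(k)}_Λ(u; x₁, x₂)| ≦ e^{−cr(e_k)}e^{−c|x₁−x₂|}. (2.47)"*.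
[Balaban1984PropagatorsII] pp. 249–250 [PDF 27–28]: *"Let us denote the covariance of the Gaussian integration in (2.152) by C^{(k)}, or by C^{(k)}_Λ …
If we denote the remaining variables by B′, then we can write B = CB′, where C is a linear operator, and we have … hence C^{(k)}_Λ = C(C\*Δ_kC)⁻¹C\*.
(2.156) By the definition of C we have of course that CB′ = 0 outside Λ, QCB′ = 0, (CB′)(Γ_{y,x}) = 0, x ∈ B(y), y ∈ Λ′ … The inequality (2.153) implies
⟨B′, C\*Δ_kCB′⟩ ≥ (γ₀/12d²)L^{−d−1}‖CB′‖² ≥ γ′₀‖B′‖², (2.157) … C is a short-ranged operator, so C\*Δ_kC has the same exponential decay as Δ_k. Now we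
may apply the theory developed in Sect. 5 of [3] on unit lattice operators. It gives us an exponential decay, and all the other properties, for the operator
(C\*Δ_kC)⁻¹, hence for C^{(k)}_Λ also."*  [BalabanImbrieJaffe1985] p. 311 [PDF 13]: *"The action Δ_k yields the unit lattice propagator C^{(k)} … (4.3.3)
The actions Δ_k and propagators C^{(k)} were studied by Balaban [6II] who established that C^{(k)} is well defined and is bounded in norm … uniformly in k.
Furthermore C^{(k)} has a kernel which decays exponentially"*.

## What is proved (0 `sorry`; axioms `propext`, `Classical.choice`, `Quot.sound`)

Carriers: pv09's torus box `pbox M ⊂ ℤ^d` (periods `M_μ`, blocks of side `L`, `L ∣ M_μ`), bond variables `B4.Idx (pbox M) d` (`(z, μ)` = the bond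
`⟨z, z + e_μ⟩`), torus distance `ρ_M` = `pdist M`; `Λ = B(Λ′₀)`; the remaining variables `B′` = `lamFree L M Λ′₀`, the elimination matrix `C_Λ` =
`elimLam L M Λ′₀`, `C^{(k)}_Λ` = `(bondReductionLam L M Λ′₀ Δ).cov = C_Λ(C_Λ*ΔC_Λ)⁻¹C_Λ*`.
* §0 `pdist_eq_dist_of_centred` (coordinate differences `≤ M_μ/2` ⇒ torus distance = `ℤ^d` distance); **`HalfBox L M Λ′₀`** (the standing geometric
  hypothesis: the remaining variables of `Λ` pairwise within `M_μ/2` in box coordinates), `pdist_eq_dist_of_halfBox`; §5 `halfBox_of_window` (a coordinate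
  window of widths `w_μ`, `2w_μ ≤ M_μ`, containing the `Λ`-bond variables suffices).
* §1 `sandwich_decay_frame`: pv09's sandwich lemma read in the pseudo-metric space of a frame (used at the periodic frame: torus distance).
* §2 **`opA L M Λ′₀ Δ γ`** `= pad_{B′}(C_Λᵀ Δ C_Λ) γ`, the (5.6) constant **`cA d L γ c₀ δ₀`** `= c₀e^{2δ₀(L−1)}(L^d+1)² + γ`; `printed_lam`, `sandwichOp_isSymm`,
  `sandwichOp_lower` ((2.157)), `sandwichOp_decay_pdist` (*"the same exponential decay as Δ_k"*, torus distance), and **`hyp56_opA`**: `B4.Hyp56 (pbox M) opA γ cA δ₀`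
  for every symmetric `Δ` with torus-distance kernel decay `(c₀, δ₀)` and the torus (2.153) `LowerOnConstrainedT L M Δ γ`, every `Λ′₀` with `HalfBox`.
* §3 `isUnit_det_sandwichOp`, **`opA_inv_coe`** (on `B′ × B′`, `A⁻¹ = (C_Λ*ΔC_Λ)⁻¹` — block-diagonal inversion), the `C_Λ`-sandwich **`sandw`** with `sandw_eq_mul`,
  `sandw_add/sub/sum`, `hasSum_sandw`, `abs_sandw_le_of_bound` (`(L^d+1)²·sup`), `abs_sandw_le_of_decay` (torus-distance decay transported, range `L − 1`),
  and **`cov_eq_sandw_inv`**: `C^{(k)}_Λ(b,b′) = Σ_{k,k′∈B′} C_Λ(b,k)A⁻¹(k,k′)C_Λ(b′,k′)`.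
* §4 for every symmetric `Δ` as above, `Λ′₀` with `HalfBox`, cubes `M_c ≥ 5`, `M_c > K_R`, `M_c > Θ₁` ([6]'s thresholds at `(γ, cA, δ₀)`, `N = d`): the walk terms
  **`walkK`** (`C_ω` of `A`), **`hasSum_walk_cov`** (the (2.42)-analog: `C^{(k)}_Λ(b,b′) = Σ_ω (C_ΛC_ωC_Λᵀ)(b,b′)`, unconditionally over all walks),
  **`eq249`** (`BIJ88Sect2Statements.Eq245` INHABITED: `C^{(k)}_Λ = C^{(k)}_{Λ,loc} + Σ_X C^{(k)}_{Λ,X}` with `C^{(k)}_{Λ,loc} = C_Λ·C_{loc}[A]·C_Λᵀ`,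
  `C^{(k)}_{Λ,X} = C_Λ·C_X[A]·C_Λᵀ`, any `ρ`, `s`), and the «similar estimates» (with `θ_W < 1`): **`abs_gLoc_le`** ((2.43)-clause "bounded as in (2.41)",
  torus distance), **`abs_cov_le_walk`** ((2.41) for `C^{(k)}_Λ` by the walk route), **`gX_support`** / `pdist_le_of_elimLam_ne_zero` ((2.46) support: non-zero
  only when `b`, `b′` are coupled by `C_Λ` — within torus distance `L − 1` — to remaining variables in blocks whose cube closures lie in `X`), **`abs_gX_le`**
  ((2.46) two-constant bound `(L^d+1)²K₀e^{−(δ₀s/(64·9^d))|X|}`), **`ineq246_gX`** (typed `Ineq246`, `c = δ₀/(256·9^d)`, for `r(e_k)` large),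
  **`abs_gLoc_sub_cov_le`** / **`close247_gauge`** ((2.47), two-constant form / typed `Close` in the torus distance, `c = δ₀/(16M_c)`).
* §6 THE GENUINE `Δ_k` (`reDelK n hn M`, every level `n ≥ 1`, `d ≥ 2`, `L ≥ 1`), hypothesis-free but for geometry, constants from `(d, L)` ONLY
  (`γ′ = gamma2153one d L = (1/12d²)L^{−d−1}`; `(c₀, δ₀)` of `kernelDecay_reDelK`, from `d`): **`hyp56_opA_DelK`**, **`hasSum_walk_cov_DelK`**, **`eq249_DelK`**,
  **`abs_cov_le_walk_DelK`**, **`ineq246_gX_DelK`**, **`close247_gauge_DelK`**.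
* §7 on the tori `Params` of the series at scale `k + 1 ≤ m + K` (p09's `idx : PBond P k ≃ B4.Idx (pbox (Mk P k)) d`, `n = L^k`): **`eq249_torus`** ((2.49) for
  `C^{(k)}_Λ(b,b′)`, `b, b′` bonds of `T₁^{(k)}`) and **`abs_covLam_le_torus`** ((2.41)/(4.3.5)/(7.2.3)-shape decay in `supDist`, by the walk route).

HONEST SCOPE / DIVERGENCE.  (i) GEOMETRY: `Λ = B(Λ′₀)` must be in HALF-TORUS POSITION in the box coordinates of pv09's fundamental domain (`HalfBox`): [6]'s
theorem and p13's expansion are typed on `ℤ^d` with its sup-distance, and the torus distance agrees with it only on centred pairs; a region wrapping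
around the box boundary or the WHOLE torus (`Λ′₀ ⊇` all coarse sites — the case in which `C^{(k)}_Λ` is the (4.3.3) propagator of [I] itself, p09's
`kernel_corner_eq_cov`) is NOT covered (for the whole torus the decay (7.2.3) is p09's `ineq723_corner`/`ineq723_torus` by the Combes–Thomas route, not a
walk expansion).  (ii) GAUGE: the constraint `δ_{Ax}` is read with Bałaban's corner-rooted trees (pv09's `IsTree`; the [6II] (2.154) object); the centred-tree
subspace `Wstep` of p30/p09 differs by the block-local regauging of `BIJ85Ineq723Torus` (whole torus only there).  (iii) INDEXING: `C^{(k)}_Λ` and its pieces are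
indexed by ALL bond variables of the box (zero rows of `C_Λ` outside the `Λ`-bonds, pv09 HONEST SCOPE (iii)); *"both arguments in X"* is read through the
outer factor `C_Λ` (range `L − 1 <` one block `≪ r(e_k)`).  (iv) DISTANCES: decay conclusions in the TORUS distance `ρ_M` (lattice units; `÷ M_c` in the
exponent = label units of p13), `|X|` = number of `r(e_k)`-cubes of `s` labels; constants explicit but not optimal.  (v) No background field `u` (the pure
gauge-field covariance has none), so the u-locality clauses of (2.43)/(2.46) are void here; the (2.48)-analog (Λ-independence) is not stated (p13's
`BIJ88Eq248Lattice` would give it for `A`, but the padding depends on `Λ`).  (vi) Four `def`s with bodies (`HalfBox` — a hypothesis predicate, `opA`, `cA`,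
`sandw`, `walkK`: five), no `def … : Prop` fact, no `sorry` (D-0026).  Unit `lit-balaban-p31` (literature-prover-lit-balaban-p31-g24-0), 2026-08-23.  NOT summit
progress.
-/

open scoped BigOperators Matrix
open Finset Matrix

namespace Literature.MathematicalPhysics.QuantumFieldTheory.BalabanImbrieJaffe1984to88.BIJ88Eq249GaugeCovarianceTorus

open Literature.MathematicalPhysics.QuantumFieldTheory.Balaban1983to89
open B6BondElimination (SubReduction pad pad_inv pad_coe hyp56_pad isUnit_det_of_lower)
open B6BondEliminationTorus (pdist pdist_le_dist zdPer PrintedPer ofPer FrameSubReduction circAbs_res)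
open B6FrameReduction (Frame)
open B6Lemma24Torus (pbox)
open B6Cov2156Torus (freeT elimT elimT_range elimT_col elimT_row one_le_M LowerOnConstrainedT)
open B6Cov2156TorusSubset (elimTS subFamilyT subFamilyT_printedPer lamFree lamFree_subset elimLam bondReductionLam
  elimTS_row IsLam mem_lamFree)
open B6Cov2156TorusDelK (reDelK reDelK_isSymm kernelDecay_reDelK lowerOnConstrainedT_reDelK_sharp gamma2153one
  gamma2153one_pos)
open B4TorusKernel.MultiPeriod (circAbs circAbs_of_centred)
open BIJ88RandomWalk242 BIJ88Eq242Lattice BIJ88Ineq246Lattice B4Sect5CubeBounds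

noncomputable section

variable {d L : ℕ} {M : Fin d → ℕ}

/-! ## §0 Half-torus geometry: torus distance = box distance on centred pairs -/

/-- kernel: if every coordinate difference of two integer representatives is at most half the period, the torus
(periodic sup-) distance `ρ_M` IS the sup-distance of `ℤ^d` (`circAbs_of_centred` coordinatewise).
[cite: BalabanImbrieJaffe1988, (2.49) p.265] -/
theorem pdist_eq_dist_of_centred (hM : ∀ i, 1 ≤ M i) {z z' : Fin d → ℤ} (h : ∀ i, 2 * |z i - z' i| ≤ (M i : ℤ)) :
    pdist M hM z z' = dist z z' := by
  refine le_antisymm (pdist_le_dist M hM z z') ?_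
  have h0 : 0 ≤ pdist M hM z z' := B4Sect5Torus.tdist_nonneg M _ _
  refine (dist_pi_le_iff h0).2 fun i => ?_
  have h1 := B4Sect5Torus.circAbs_le_tdist hM (B6BondEliminationTorus.res M hM z) (B6BondEliminationTorus.res M hM z') i
  rw [circAbs_res, circAbs_of_centred (hM i) (h i)] at h1
  rw [Int.dist_eq]
  have h2 : (((|z i - z' i| : ℤ)) : ℝ) = |((z i : ℝ)) - (z' i : ℝ)| := by push_cast; rfl
  rw [← h2]
  exact h1

variable (L M) in
/-- **HALF-TORUS POSITION OF `Λ`** (the standing geometric hypothesis of this file): the remaining bond variables `B′` of the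
`Λ`-integral (pv09's `lamFree`: the `Λ`-bonds other than pivots and tree bonds), read as integer representatives in the box
`∏[0, M_μ)`, have pairwise coordinate differences `≤ M_μ/2` — so that on them the torus distance is the `ℤ^d` distance of [6]
Sect. 5 (`pdist_eq_dist_of_centred`), the carrier on which the walk expansion (2.42) is built ("ω is a walk on a lattice").
[cite: BalabanImbrieJaffe1988, (2.42) p.264, (2.49) p.265] -/
def HalfBox (Λ'₀ : Finset (Fin d → ℤ)) : Prop :=
  ∀ k ∈ lamFree L M Λ'₀, ∀ k' ∈ lamFree L M Λ'₀, ∀ i, 2 * |(k.1 : Fin d → ℤ) i - (k'.1 : Fin d → ℤ) i| ≤ (M i : ℤ)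

/-- kernel: under `HalfBox`, `ρ_M(k, k′) = |k − k′|_{ℤ^d}` for remaining variables `k, k′` of `Λ`. [cite: BalabanImbrieJaffe1988, (2.49) p.265] -/
theorem pdist_eq_dist_of_halfBox [∀ μ, NeZero (M μ)] {Λ'₀ : Finset (Fin d → ℤ)} (h : HalfBox L M Λ'₀)
    (k k' : ↥(lamFree L M Λ'₀)) :
    pdist M (one_le_M M) ((k : B4.Idx (pbox M) d).1 : Fin d → ℤ) ((k' : B4.Idx (pbox M) d).1 : Fin d → ℤ) =
      dist ((k : B4.Idx (pbox M) d).1 : Fin d → ℤ) ((k' : B4.Idx (pbox M) d).1 : Fin d → ℤ) :=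
  pdist_eq_dist_of_centred (one_le_M M) (h k.1 k.2 k'.1 k'.2)

/-! ## §1 «C is a short-ranged operator, so C*Δ_kC has the same exponential decay as Δ_k» over a frame -/

/-- kernel (pv09's `B6FromB4.sandwich_decay` read in the pseudo-metric space of a frame, e.g. the periodic frame whose distance is
the torus distance `ρ_M`): `|(LDR)(i,k)| ≤ c₀e^{2δ₀r}m_lm_r·e^{−δ₀ρ(i,k)}` for `D` with `ρ`-decay `(c₀, δ₀)` and factors of `ρ`-range `≤ r`
and `ℓ¹` sums `≤ m_l`, `m_r`. [cite: Balaban1984PropagatorsII, (2.156)–(2.157) p.250] -/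
theorem sandwich_decay_frame (F : Frame) {m n : Type} [Fintype m] {r c₀ δ₀ ml mr : ℝ} (pos : m → F.S) (pos' : n → F.S)
    (Lm : Matrix n m ℝ) (D : Matrix m m ℝ) (R : Matrix m n ℝ) (hc : 0 ≤ c₀) (hδ : 0 ≤ δ₀)
    (hL : ∀ i u, Lm i u ≠ 0 → F.ρ (pos' i) (pos u) ≤ r) (hL1 : ∀ i, ∑ u, |Lm i u| ≤ ml)
    (hR : ∀ v k, R v k ≠ 0 → F.ρ (pos v) (pos' k) ≤ r) (hR1 : ∀ k, ∑ v, |R v k| ≤ mr)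
    (hD : ∀ u v, |D u v| ≤ c₀ * Real.exp (-(δ₀ * F.ρ (pos u) (pos v)))) :
    ∀ i k, |(Lm * D * R) i k| ≤ c₀ * Real.exp (2 * δ₀ * r) * ml * mr * Real.exp (-(δ₀ * F.ρ (pos' i) (pos' k))) := by
  letI : PseudoMetricSpace F.S := F.pms
  exact B6FromB4.sandwich_decay pos pos' Lm D R hc hδ hL hL1 hR hR1 hD

/-! ## §2 The [6]-operator of the gauge-field covariance and its (5.6) -/

variable [∀ μ, NeZero (M μ)]

variable (L M) in
/-- **THE [6]-OPERATOR OF THE GAUGE-FIELD COVARIANCE `C^{(k)}_Λ`** ([6II] p. 250: *"we can write B = CB′ … C^{(k)}_Λ = C(C*Δ_kC)⁻¹C*.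
(2.156) … Now we may apply the theory developed in Sect. 5 of [3] on unit lattice operators … for the operator (C*Δ_kC)⁻¹"*): the
reduced operator `C_Λ*Δ_kC_Λ` on the remaining variables `B′` of `Λ = B(Λ′₀)` (pv09's `elimLam`, `lamFree`), PADDED by `γ·1` on the
removed variables (pv09's `B6BondElimination.pad`) to an operator on ALL bond variables `(pbox M) × Fin d` of the torus box — a
`B4.Idx`-indexed operator on `L²(Ω; ℝ^N)`, `Ω = ∏[0,M_μ) ⊂ ℤ^d`, `N = d`, the carrier of [6] Sect. 5 and of p13's (2.42).
[cite: BalabanImbrieJaffe1988, (2.49) p.265; Balaban1984PropagatorsII, (2.156) p.250] -/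
def opA (Λ'₀ : Finset (Fin d → ℤ)) (Δ : Matrix (B4.Idx (pbox M) d) (B4.Idx (pbox M) d) ℝ) (γ : ℝ) :
    Matrix (B4.Idx (pbox M) d) (B4.Idx (pbox M) d) ℝ :=
  pad (lamFree L M Λ'₀) ((elimLam L M Λ'₀)ᵀ * Δ * elimLam L M Λ'₀) γ

/-- the (5.6) kernel constant of the padded reduced operator: `c₀e^{2δ₀(L−1)}(L^d+1)² + γ` (range `L − 1` and `ℓ¹` sums `≤ L^d + 1` of
`C_Λ`, pv09's `subFamilyT_printedPer`; `+ γ` from the padding). [cite: Balaban1984PropagatorsII, (2.157) p.250] -/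
def cA (d L : ℕ) (γ c₀ δ₀ : ℝ) : ℝ :=
  c₀ * Real.exp (2 * δ₀ * ((L : ℝ) - 1)) * ((L : ℝ) ^ d + 1) * ((L : ℝ) ^ d + 1) + γ

variable {Λ'₀ : Finset (Fin d → ℤ)} {Δ : Matrix (B4.Idx (pbox M) d) (B4.Idx (pbox M) d) ℝ} {γ c₀ δ₀ : ℝ}

/-- kernel: the printed-shape inputs of the `Λ`-reduction in the torus distance (pv09's `subFamilyT_printedPer`), as the structure.
[cite: Balaban1984PropagatorsII, (2.153)–(2.157) pp.249–250] -/
theorem printed_lam (hL : 0 < L) (hLM : ∀ i, L ∣ M i) (hs : Δ.IsSymm)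
    (hd : ∀ p q : B4.Idx (pbox M) d,
      |Δ p q| ≤ c₀ * Real.exp (-(δ₀ * pdist M (one_le_M M) (p.1 : Fin d → ℤ) (q.1 : Fin d → ℤ))))
    (hl : LowerOnConstrainedT L M Δ γ) :
    (ofPer M (one_le_M M) (bondReductionLam L M Λ'₀ Δ)).Printed γ c₀ δ₀ ((L : ℝ) - 1) ((L : ℝ) ^ d + 1) :=
  subFamilyT_printedPer (hS := lamFree_subset L M Λ'₀) hL hLM hs hd hl

omit [∀ μ, NeZero (M μ)] in
/-- kernel: `C_Λ*Δ_kC_Λ` is symmetric. [cite: Balaban1984PropagatorsII, (2.157) p.250] -/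
theorem sandwichOp_isSymm (hs : Δ.IsSymm) : ((elimLam L M Λ'₀)ᵀ * Δ * elimLam L M Λ'₀).IsSymm :=
  B6FromB4.sandwich_isSymm _ hs

/-- kernel, (2.157): `⟨B′, C_Λ*Δ_kC_ΛB′⟩ ≥ γ‖B′‖²` from the torus (2.153) with constant `γ` (pv09: `C_ΛB′` lies in the constrained
subspace, `‖C_ΛB′‖ ≥ ‖B′‖`). [cite: Balaban1984PropagatorsII, (2.157) p.250] -/
theorem sandwichOp_lower (hL : 0 < L) (hLM : ∀ i, L ∣ M i) (hγ : 0 ≤ γ) (hs : Δ.IsSymm)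
    (hd : ∀ p q : B4.Idx (pbox M) d,
      |Δ p q| ≤ c₀ * Real.exp (-(δ₀ * pdist M (one_le_M M) (p.1 : Fin d → ℤ) (q.1 : Fin d → ℤ))))
    (hl : LowerOnConstrainedT L M Δ γ) (w : ↥(lamFree L M Λ'₀) → ℝ) :
    γ * ∑ k, w k ^ 2 ≤ ∑ k, w k * (((elimLam L M Λ'₀)ᵀ * Δ * elimLam L M Λ'₀) *ᵥ w) k :=
  B6FromB4.sandwich_lowerBound (elimLam L M Λ'₀) Δ hγ (printed_lam hL hLM hs hd hl).lower (printed_lam hL hLM hs hd hl).iso w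

/-- kernel, «C*Δ_kC has the same exponential decay as Δ_k» IN THE TORUS DISTANCE: `|C_Λ*Δ_kC_Λ(k,k′)| ≤ c₀e^{2δ₀(L−1)}(L^d+1)²e^{−δ₀ρ_M(k,k′)}`.
[cite: Balaban1984PropagatorsII, p.250] -/
theorem sandwichOp_decay_pdist (hL : 0 < L) (hLM : ∀ i, L ∣ M i) (hc : 0 ≤ c₀) (hδ : 0 ≤ δ₀) (hs : Δ.IsSymm)
    (hd : ∀ p q : B4.Idx (pbox M) d,
      |Δ p q| ≤ c₀ * Real.exp (-(δ₀ * pdist M (one_le_M M) (p.1 : Fin d → ℤ) (q.1 : Fin d → ℤ))))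
    (hl : LowerOnConstrainedT L M Δ γ) (k k' : ↥(lamFree L M Λ'₀)) :
    |((elimLam L M Λ'₀)ᵀ * Δ * elimLam L M Λ'₀) k k'| ≤
      c₀ * Real.exp (2 * δ₀ * ((L : ℝ) - 1)) * ((L : ℝ) ^ d + 1) * ((L : ℝ) ^ d + 1) *
        Real.exp (-(δ₀ * pdist M (one_le_M M) ((k : B4.Idx (pbox M) d).1 : Fin d → ℤ) ((k' : B4.Idx (pbox M) d).1 : Fin d → ℤ))) := by
  have hP := printed_lam (Λ'₀ := Λ'₀) hL hLM hs hd hl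
  have hrange : ∀ (p : B4.Idx (pbox M) d) (k : ↥(lamFree L M Λ'₀)), elimLam L M Λ'₀ p k ≠ 0 →
      pdist M (one_le_M M) (p.1 : Fin d → ℤ) ((k : B4.Idx (pbox M) d).1 : Fin d → ℤ) ≤ (L : ℝ) - 1 := hP.range
  have hcol : ∀ k : ↥(lamFree L M Λ'₀), ∑ p, |elimLam L M Λ'₀ p k| ≤ (L : ℝ) ^ d + 1 := hP.col
  have hdec : ∀ p q : B4.Idx (pbox M) d,
      |Δ p q| ≤ c₀ * Real.exp (-(δ₀ * pdist M (one_le_M M) (p.1 : Fin d → ℤ) (q.1 : Fin d → ℤ))) := hd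
  refine sandwich_decay_frame (zdPer d M (one_le_M M)) (fun u : B4.Idx (pbox M) d => (u.1 : Fin d → ℤ))
    (fun k : ↥(lamFree L M Λ'₀) => ((k : B4.Idx (pbox M) d).1 : Fin d → ℤ)) (elimLam L M Λ'₀)ᵀ Δ (elimLam L M Λ'₀) hc hδ
    (fun i u h => ?_) (fun i => ?_) hrange hcol hdec k k'
  · rw [Matrix.transpose_apply] at h
    have h1 := hrange u i h
    rwa [show pdist M (one_le_M M) (u.1 : Fin d → ℤ) ((i : B4.Idx (pbox M) d).1 : Fin d → ℤ) =
      pdist M (one_le_M M) ((i : B4.Idx (pbox M) d).1 : Fin d → ℤ) (u.1 : Fin d → ℤ) from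
      B4Sect5Torus.tdist_symm (one_le_M M) _ _] at h1
  · simp only [Matrix.transpose_apply]
    exact hcol i

/-- **[6] (5.6) FOR THE [6]-OPERATOR OF THE GAUGE-FIELD COVARIANCE** ([6II] p. 250 *"⟨B′, C*Δ_kCB′⟩ ≥ … ≥ γ′₀‖B′‖², (2.157) … C is a
short-ranged operator, so C*Δ_kC has the same exponential decay as Δ_k. Now we may apply the theory developed in Sect. 5 of [3]"*; [BIJ88]
p. 265 (2.49) *"analogous to (2.45)"*): for every torus (`L ∣ M_μ`), every symmetric `Δ_k` on its bond variables with torus-distance kernel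
decay `(c₀, δ₀)` and the (2.153) lower bound `γ` on `{QB = 0, B(Γ_{y,x}) = 0}`, and every `Λ = B(Λ′₀)` in half-torus position, the operator
`opA` satisfies p13's/[6]'s hypothesis `B4.Hyp56` on `Ω = ∏[0,M_μ) ⊂ ℤ^d`, `N = d`, with `(γ, c₀e^{2δ₀(L−1)}(L^d+1)² + γ, δ₀)`.
[cite: BalabanImbrieJaffe1988, (2.49) p.265; Balaban1984PropagatorsII, (2.157) p.250; Balaban1983RegularityDecay, (5.6) p.594] -/
theorem hyp56_opA (hL : 0 < L) (hLM : ∀ i, L ∣ M i) (hγ : 0 ≤ γ) (hc : 0 ≤ c₀) (hδ : 0 ≤ δ₀) (hs : Δ.IsSymm)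
    (hd : ∀ p q : B4.Idx (pbox M) d,
      |Δ p q| ≤ c₀ * Real.exp (-(δ₀ * pdist M (one_le_M M) (p.1 : Fin d → ℤ) (q.1 : Fin d → ℤ))))
    (hl : LowerOnConstrainedT L M Δ γ) (hbox : HalfBox L M Λ'₀) :
    B4.Hyp56 (pbox M) (opA L M Λ'₀ Δ γ) γ (cA d L γ c₀ δ₀) δ₀ := by
  refine hyp56_pad hγ (by positivity) (sandwichOp_isSymm hs) (sandwichOp_lower hL hLM hγ hs hd hl) fun k k' => ?_
  rw [← pdist_eq_dist_of_halfBox hbox k k']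
  exact sandwichOp_decay_pdist hL hLM hc hδ hs hd hl k k'

/-- kernel: the (5.6) kernel constant is non-negative. [cite: Balaban1984PropagatorsII, (2.157) p.250] -/
theorem cA_nonneg (d L : ℕ) (hγ : 0 ≤ γ) (hc : 0 ≤ c₀) (δ₀ : ℝ) : 0 ≤ cA d L γ c₀ δ₀ := by
  unfold cA; positivity

/-! ## §3 (2.156) through the [6]-operator: `C^{(k)}_Λ = C_Λ·(A⁻¹ on B′)·C_Λᵀ` -/

/-- kernel: `C_Λ*Δ_kC_Λ` is invertible (its form is `≥ γ‖·‖²`, `γ > 0`). [cite: Balaban1984PropagatorsII, (2.157) p.250] -/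
theorem isUnit_det_sandwichOp (hL : 0 < L) (hLM : ∀ i, L ∣ M i) (hγ : 0 < γ) (hs : Δ.IsSymm)
    (hd : ∀ p q : B4.Idx (pbox M) d,
      |Δ p q| ≤ c₀ * Real.exp (-(δ₀ * pdist M (one_le_M M) (p.1 : Fin d → ℤ) (q.1 : Fin d → ℤ))))
    (hl : LowerOnConstrainedT L M Δ γ) : IsUnit ((elimLam L M Λ'₀)ᵀ * Δ * elimLam L M Λ'₀).det :=
  isUnit_det_of_lower hγ (sandwichOp_lower hL hLM hγ.le hs hd hl)

/-- kernel: ON THE REMAINING VARIABLES the inverse of the padded operator IS `(C_Λ*Δ_kC_Λ)⁻¹` (block-diagonal inversion, pv09's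
`pad_inv`) — *"It gives us … all the other properties, for the operator (C*Δ_kC)⁻¹"*. [cite: Balaban1984PropagatorsII, (2.156) p.250] -/
theorem opA_inv_coe (hL : 0 < L) (hLM : ∀ i, L ∣ M i) (hγ : 0 < γ) (hs : Δ.IsSymm)
    (hd : ∀ p q : B4.Idx (pbox M) d,
      |Δ p q| ≤ c₀ * Real.exp (-(δ₀ * pdist M (one_le_M M) (p.1 : Fin d → ℤ) (q.1 : Fin d → ℤ))))
    (hl : LowerOnConstrainedT L M Δ γ) (k k' : ↥(lamFree L M Λ'₀)) :
    (opA L M Λ'₀ Δ γ)⁻¹ k k' = ((elimLam L M Λ'₀)ᵀ * Δ * elimLam L M Λ'₀)⁻¹ k k' := by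
  unfold opA
  rw [pad_inv _ (isUnit_det_sandwichOp hL hLM hγ hs hd hl) hγ.ne', pad_coe]

variable (L M) in
/-- **THE `C_Λ`-SANDWICH** `(C_Λ K C_Λᵀ)(b, b′) = Σ_{k′}(Σ_k C_Λ(b,k)K(k,k′))C_Λ(b′,k′)` of a kernel `K` on the remaining variables — the
shape *"C(·)C*"* of (2.156) *"hence for C^{(k)}_Λ also"*, by which every piece of the walk expansion of `A⁻¹` becomes a piece of `C^{(k)}_Λ`.
[cite: Balaban1984PropagatorsII, (2.156) p.250; BalabanImbrieJaffe1988, (2.49) p.265] -/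
def sandw (Λ'₀ : Finset (Fin d → ℤ)) (K : B4.Idx (pbox M) d → B4.Idx (pbox M) d → ℝ) (b b' : B4.Idx (pbox M) d) : ℝ :=
  ∑ k' : ↥(lamFree L M Λ'₀), (∑ k : ↥(lamFree L M Λ'₀), elimLam L M Λ'₀ b k * K k k') * elimLam L M Λ'₀ b' k'

omit [∀ μ, NeZero (M μ)] in
/-- kernel: the sandwich is the matrix entry of `C_Λ · K|_{B′} · C_Λᵀ`. [cite: Balaban1984PropagatorsII, (2.156) p.250] -/
theorem sandw_eq_mul (K : B4.Idx (pbox M) d → B4.Idx (pbox M) d → ℝ) (b b' : B4.Idx (pbox M) d) :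
    sandw L M Λ'₀ K b b' =
      (elimLam L M Λ'₀ * Matrix.of (fun k k' : ↥(lamFree L M Λ'₀) => K k k') * (elimLam L M Λ'₀)ᵀ) b b' := by
  simp only [sandw, Matrix.mul_apply, Matrix.of_apply, Matrix.transpose_apply]

omit [∀ μ, NeZero (M μ)] in
/-- kernel: the sandwich is additive in the kernel (bookkeeping for the `Σ` of (2.49)). [cite: BalabanImbrieJaffe1988, (2.49) p.265] -/
theorem sandw_add (K K' : B4.Idx (pbox M) d → B4.Idx (pbox M) d → ℝ) (b b' : B4.Idx (pbox M) d) :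
    sandw L M Λ'₀ (fun p q => K p q + K' p q) b b' = sandw L M Λ'₀ K b b' + sandw L M Λ'₀ K' b b' := by
  simp only [sandw, mul_add, add_mul, Finset.sum_add_distrib]

omit [∀ μ, NeZero (M μ)] in
/-- kernel: the sandwich is subtractive in the kernel (bookkeeping for (2.47)). [cite: BalabanImbrieJaffe1988, (2.47) p.265] -/
theorem sandw_sub (K K' : B4.Idx (pbox M) d → B4.Idx (pbox M) d → ℝ) (b b' : B4.Idx (pbox M) d) :
    sandw L M Λ'₀ (fun p q => K p q - K' p q) b b' = sandw L M Λ'₀ K b b' - sandw L M Λ'₀ K' b b' := by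
  simp only [sandw, mul_sub, sub_mul, Finset.sum_sub_distrib]

omit [∀ μ, NeZero (M μ)] in
/-- kernel: the sandwich commutes with finite sums of kernels (the `Σ_X` of (2.49)). [cite: BalabanImbrieJaffe1988, (2.49) p.265] -/
theorem sandw_sum {ξ : Type*} (s : Finset ξ) (K : ξ → B4.Idx (pbox M) d → B4.Idx (pbox M) d → ℝ) (b b' : B4.Idx (pbox M) d) :
    sandw L M Λ'₀ (fun p q => ∑ X ∈ s, K X p q) b b' = ∑ X ∈ s, sandw L M Λ'₀ (K X) b b' := by
  classical
  induction s using Finset.induction_on with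
  | empty =>
    simp only [Finset.sum_empty]
    simp [sandw]
  | insert a s ha ih =>
    simp only [Finset.sum_insert ha]
    rw [← ih, ← sandw_add]

omit [∀ μ, NeZero (M μ)] in
/-- kernel: the sandwich of an unconditionally convergent series of kernels converges to the sandwich of the sum (finite linear
combination of `HasSum`s). [cite: BalabanImbrieJaffe1988, (2.42) p.264] -/
theorem hasSum_sandw {ι' : Type*} {f : ι' → B4.Idx (pbox M) d → B4.Idx (pbox M) d → ℝ}
    {K : B4.Idx (pbox M) d → B4.Idx (pbox M) d → ℝ}
    (h : ∀ k k' : ↥(lamFree L M Λ'₀), HasSum (fun ω => f ω k k') (K k k')) (b b' : B4.Idx (pbox M) d) :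
    HasSum (fun ω => sandw L M Λ'₀ (f ω) b b') (sandw L M Λ'₀ K b b') := by
  unfold sandw
  refine hasSum_sum fun k' _ => ?_
  exact (hasSum_sum fun k _ => (h k k').mul_left (elimLam L M Λ'₀ b k)).mul_right (elimLam L M Λ'₀ b' k')

omit [∀ μ, NeZero (M μ)] in
/-- kernel: `|C_Λ K C_Λᵀ(b,b′)| ≤ (L^d+1)²·B` when `|K| ≤ B` on the remaining variables (row sums of `C_Λ` are `≤ L^d`).
[cite: Balaban1984PropagatorsII, (2.156) p.250] -/
theorem abs_sandw_le_of_bound (hL : 0 < L) {K : B4.Idx (pbox M) d → B4.Idx (pbox M) d → ℝ} {B : ℝ} (hB : 0 ≤ B)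
    (hK : ∀ k k' : ↥(lamFree L M Λ'₀), |K k k'| ≤ B) (b b' : B4.Idx (pbox M) d) :
    |sandw L M Λ'₀ K b b'| ≤ ((L : ℝ) ^ d + 1) * ((L : ℝ) ^ d + 1) * B := by
  have hrow : ∀ p : B4.Idx (pbox M) d, ∑ k : ↥(lamFree L M Λ'₀), |elimLam L M Λ'₀ p k| ≤ (L : ℝ) ^ d + 1 := fun p =>
    (elimTS_row (lamFree_subset L M Λ'₀) hL p).trans (by linarith)
  unfold sandw
  calc |∑ k' : ↥(lamFree L M Λ'₀), (∑ k : ↥(lamFree L M Λ'₀), elimLam L M Λ'₀ b k * K k k') * elimLam L M Λ'₀ b' k'|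
      ≤ ∑ k' : ↥(lamFree L M Λ'₀), |(∑ k : ↥(lamFree L M Λ'₀), elimLam L M Λ'₀ b k * K k k') * elimLam L M Λ'₀ b' k'| :=
        Finset.abs_sum_le_sum_abs _ _
    _ ≤ ∑ k' : ↥(lamFree L M Λ'₀), ((∑ k : ↥(lamFree L M Λ'₀), |elimLam L M Λ'₀ b k|) * B) * |elimLam L M Λ'₀ b' k'| := by
        refine Finset.sum_le_sum fun k' _ => ?_
        rw [abs_mul]
        refine mul_le_mul_of_nonneg_right ?_ (abs_nonneg _)
        refine (Finset.abs_sum_le_sum_abs _ _).trans ?_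
        rw [Finset.sum_mul]
        refine Finset.sum_le_sum fun k _ => ?_
        rw [abs_mul]
        exact mul_le_mul_of_nonneg_left (hK k k') (abs_nonneg _)
    _ = (∑ k : ↥(lamFree L M Λ'₀), |elimLam L M Λ'₀ b k|) * B * ∑ k' : ↥(lamFree L M Λ'₀), |elimLam L M Λ'₀ b' k'| := by
        rw [Finset.mul_sum]
    _ ≤ ((L : ℝ) ^ d + 1) * B * ((L : ℝ) ^ d + 1) := by
        have h1 := hrow b
        have h2 := hrow b'
        have h3 : 0 ≤ ∑ k' : ↥(lamFree L M Λ'₀), |elimLam L M Λ'₀ b' k'| := Finset.sum_nonneg fun _ _ => abs_nonneg _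
        calc (∑ k : ↥(lamFree L M Λ'₀), |elimLam L M Λ'₀ b k|) * B * ∑ k' : ↥(lamFree L M Λ'₀), |elimLam L M Λ'₀ b' k'|
            ≤ ((L : ℝ) ^ d + 1) * B * ∑ k' : ↥(lamFree L M Λ'₀), |elimLam L M Λ'₀ b' k'| :=
              mul_le_mul_of_nonneg_right (mul_le_mul_of_nonneg_right h1 hB) h3
          _ ≤ ((L : ℝ) ^ d + 1) * B * ((L : ℝ) ^ d + 1) := mul_le_mul_of_nonneg_left h2 (by positivity)
    _ = ((L : ℝ) ^ d + 1) * ((L : ℝ) ^ d + 1) * B := by ring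

/-- kernel: a kernel with decay `(K₁, δ)` IN THE TORUS DISTANCE on the remaining variables has a sandwich with decay
`(K₁e^{2δ(L−1)}(L^d+1)², δ)` in the torus distance (§1 with `(L, R) = (C_Λ, C_Λᵀ)`). [cite: Balaban1984PropagatorsII, (2.156) p.250] -/
theorem abs_sandw_le_of_decay (hL : 0 < L) (hLM : ∀ i, L ∣ M i) (hs : Δ.IsSymm)
    (hd : ∀ p q : B4.Idx (pbox M) d,
      |Δ p q| ≤ c₀ * Real.exp (-(δ₀ * pdist M (one_le_M M) (p.1 : Fin d → ℤ) (q.1 : Fin d → ℤ))))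
    (hl : LowerOnConstrainedT L M Δ γ)
    {K : B4.Idx (pbox M) d → B4.Idx (pbox M) d → ℝ} {K₁ δ : ℝ} (hK₁ : 0 ≤ K₁) (hδ : 0 ≤ δ)
    (hK : ∀ k k' : ↥(lamFree L M Λ'₀), |K k k'| ≤ K₁ * Real.exp (-(δ *
      pdist M (one_le_M M) ((k : B4.Idx (pbox M) d).1 : Fin d → ℤ) ((k' : B4.Idx (pbox M) d).1 : Fin d → ℤ))))
    (b b' : B4.Idx (pbox M) d) :
    |sandw L M Λ'₀ K b b'| ≤ K₁ * Real.exp (2 * δ * ((L : ℝ) - 1)) * ((L : ℝ) ^ d + 1) * ((L : ℝ) ^ d + 1) *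
      Real.exp (-(δ * pdist M (one_le_M M) (b.1 : Fin d → ℤ) (b'.1 : Fin d → ℤ))) := by
  have hP := printed_lam (Λ'₀ := Λ'₀) hL hLM hs hd hl
  have hrange : ∀ (p : B4.Idx (pbox M) d) (k : ↥(lamFree L M Λ'₀)), elimLam L M Λ'₀ p k ≠ 0 →
      pdist M (one_le_M M) (p.1 : Fin d → ℤ) ((k : B4.Idx (pbox M) d).1 : Fin d → ℤ) ≤ (L : ℝ) - 1 := hP.range
  have hrow : ∀ p : B4.Idx (pbox M) d, ∑ k : ↥(lamFree L M Λ'₀), |elimLam L M Λ'₀ p k| ≤ (L : ℝ) ^ d + 1 := fun p =>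
    (elimTS_row (lamFree_subset L M Λ'₀) hL p).trans (by linarith)
  rw [sandw_eq_mul]
  refine sandwich_decay_frame (zdPer d M (one_le_M M)) (fun k : ↥(lamFree L M Λ'₀) => ((k : B4.Idx (pbox M) d).1 : Fin d → ℤ))
    (fun u : B4.Idx (pbox M) d => (u.1 : Fin d → ℤ)) (elimLam L M Λ'₀) (Matrix.of fun k k' : ↥(lamFree L M Λ'₀) => K k k')
    (elimLam L M Λ'₀)ᵀ hK₁ hδ hrange hrow (fun v k h => ?_) (fun k => ?_) (fun u v => ?_) b b'
  · rw [Matrix.transpose_apply] at h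
    have h1 := hrange k v h
    rwa [show pdist M (one_le_M M) ((k : B4.Idx (pbox M) d).1 : Fin d → ℤ) ((v : B4.Idx (pbox M) d).1 : Fin d → ℤ) =
      pdist M (one_le_M M) ((v : B4.Idx (pbox M) d).1 : Fin d → ℤ) ((k : B4.Idx (pbox M) d).1 : Fin d → ℤ) from
      B4Sect5Torus.tdist_symm (one_le_M M) _ _] at h1
  · simp only [Matrix.transpose_apply]
    exact hrow k
  · rw [Matrix.of_apply]
    exact hK u v

/-- **(2.156) THROUGH THE [6]-OPERATOR**: `C^{(k)}_Λ(b, b′) = Σ_{k,k′ ∈ B′} C_Λ(b,k)·A⁻¹(k,k′)·C_Λ(b′,k′)` — pv09's covariance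
`bondReductionLam … .cov = C_Λ(C_Λ*Δ_kC_Λ)⁻¹C_Λ*` with the middle factor read off the padded operator.
[cite: Balaban1984PropagatorsII, (2.156) p.250; BalabanImbrieJaffe1988, (2.49) p.265] -/
theorem cov_eq_sandw_inv (hL : 0 < L) (hLM : ∀ i, L ∣ M i) (hγ : 0 < γ) (hs : Δ.IsSymm)
    (hd : ∀ p q : B4.Idx (pbox M) d,
      |Δ p q| ≤ c₀ * Real.exp (-(δ₀ * pdist M (one_le_M M) (p.1 : Fin d → ℤ) (q.1 : Fin d → ℤ))))
    (hl : LowerOnConstrainedT L M Δ γ) (b b' : B4.Idx (pbox M) d) :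
    (bondReductionLam L M Λ'₀ Δ).cov b b' = sandw L M Λ'₀ (fun p q => (opA L M Λ'₀ Δ γ)⁻¹ p q) b b' := by
  rw [sandw_eq_mul]
  have h : (Matrix.of fun k k' : ↥(lamFree L M Λ'₀) => (opA L M Λ'₀ Δ γ)⁻¹ k k') =
      ((elimLam L M Λ'₀)ᵀ * Δ * elimLam L M Λ'₀)⁻¹ := by
    ext k k'
    rw [Matrix.of_apply, opA_inv_coe hL hLM hγ hs hd hl]
  rw [h]
  rfl

/-! ## §4 THE WALK EXPANSION OF `C^{(k)}_Λ` AND (2.49), WITH THE «SIMILAR ESTIMATES» (p13 BY NAME on the [6]-operator) -/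

variable (L M) in
/-- the walk terms `C_ω` ([6] (5.17), p13's `latticeCw`) of the [6]-operator `A` of the gauge-field covariance, on walks `ω` over the
`M_c`-cubes of the box `∏[0,M_μ) ⊂ ℤ^d` ("ω is a walk on a lattice of spacing M = O(1)", p. 264). [cite: BalabanImbrieJaffe1988, (2.42) p.264, (2.49) p.265] -/
def walkK (Λ'₀ : Finset (Fin d → ℤ)) (Δ : Matrix (B4.Idx (pbox M) d) (B4.Idx (pbox M) d) ℝ) (γ : ℝ) (Mc : ℕ)
    (ω : Walk ↥(labels Mc (pbox M))) : B4.Idx (pbox M) d → B4.Idx (pbox M) d → ℝ :=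
  fun p q => latticeCw Mc (pbox M) d (opA L M Λ'₀ Δ γ) ω p q

/-- **THE RANDOM WALK EXPANSION OF THE GAUGE-FIELD COVARIANCE** (the (2.42)-analog of (2.49) *"a random walk expansion analogous to
(2.45)"*): `C^{(k)}_Λ(b, b′) = Σ_ω (C_Λ C_ω C_Λᵀ)(b, b′)`, the sum over ALL walks on the `M_c`-cubes converging unconditionally, for cubes
`M_c ≥ 5`, `M_c > K_R`, `M_c > Θ₁` ([6]'s thresholds at `(γ, c_A, δ₀)`, `N = d`) — p13's `eq242_lattice` on `A` + §3.
[cite: BalabanImbrieJaffe1988, (2.42) p.264, (2.49) p.265] -/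
theorem hasSum_walk_cov (hL : 0 < L) (hLM : ∀ i, L ∣ M i) (hγ : 0 < γ) (hc : 0 ≤ c₀) (hδ : 0 < δ₀) (hs : Δ.IsSymm)
    (hd : ∀ p q : B4.Idx (pbox M) d,
      |Δ p q| ≤ c₀ * Real.exp (-(δ₀ * pdist M (one_le_M M) (p.1 : Fin d → ℤ) (q.1 : Fin d → ℤ))))
    (hl : LowerOnConstrainedT L M Δ γ) (hbox : HalfBox L M Λ'₀) {Mc : ℕ} (hM5 : 5 ≤ Mc)
    (hMR : kR d d γ (cA d L γ c₀ δ₀) δ₀ < Mc) (hMθ : thetaConst d d γ (cA d L γ c₀ δ₀) δ₀ < Mc) (b b' : B4.Idx (pbox M) d) :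
    HasSum (fun ω => sandw L M Λ'₀ (walkK L M Λ'₀ Δ γ Mc ω) b b') ((bondReductionLam L M Λ'₀ Δ).cov b b') := by
  rw [cov_eq_sandw_inv hL hLM hγ hs hd hl]
  exact hasSum_sandw (fun k k' => eq242_lattice hγ (cA_nonneg d L hγ.le hc δ₀) hδ
    (hyp56_opA hL hLM hγ.le hc hδ.le hs hd hl hbox) hM5 hMR hMθ k k') b b'

/-- **(2.49) `C^{(k)}_Λ = C^{(k)}_{Λ,loc} + Σ_X C^{(k)}_{Λ,X}` FOR THE GAUGE-FIELD COVARIANCE OF RECORD** (p. 265 *"Lastly we note that the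
single-step covariance for the gauge field can be given a random walk expansion analogous to (2.45), with similar estimates"*): the typed
row `BIJ88Sect2Statements.Eq245` INHABITED by `C^{(k)}_Λ(b,b′) = C_Λ(C_Λ*Δ_kC_Λ)⁻¹C_Λ*(b,b′)` of [6II] (2.156) with
`C^{(k)}_{Λ,loc} := C_Λ·C_{loc}[A]·C_Λᵀ` (walks within `ρ` label units of both remaining variables) and `C^{(k)}_{Λ,X} := C_Λ·C_X[A]·C_Λᵀ`
(walks filling the region `X` of `r(e_k)`-cubes of `s` labels a side, touching adjacency) — p13's `eq245_lattice` on the [6]-operator `A` of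
§2 (its (5.6) = `hyp56_opA`), sandwiched (§3).  Every torus `L ∣ M_μ`, every symmetric `Δ_k` with torus decay `(c₀, δ₀)` and (2.153)-`γ`,
every `Λ = B(Λ′₀)` in half-torus position, cubes `M_c ≥ 5`, `M_c > K_R`, `M_c > Θ₁`, every `ρ`, `s`.
[cite: BalabanImbrieJaffe1988, (2.49) p.265, (2.45) p.264] -/
theorem eq249 (hL : 0 < L) (hLM : ∀ i, L ∣ M i) (hγ : 0 < γ) (hc : 0 ≤ c₀) (hδ : 0 < δ₀) (hs : Δ.IsSymm)
    (hd : ∀ p q : B4.Idx (pbox M) d,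
      |Δ p q| ≤ c₀ * Real.exp (-(δ₀ * pdist M (one_le_M M) (p.1 : Fin d → ℤ) (q.1 : Fin d → ℤ))))
    (hl : LowerOnConstrainedT L M Δ γ) (hbox : HalfBox L M Λ'₀) {Mc : ℕ} (hM5 : 5 ≤ Mc)
    (hMR : kR d d γ (cA d L γ c₀ δ₀) δ₀ < Mc) (hMθ : thetaConst d d γ (cA d L γ c₀ δ₀) δ₀ < Mc) (ρ : ℝ) (s : ℕ) :
    BIJ88Sect2Statements.Eq245 (fun b b' : B4.Idx (pbox M) d => (bondReductionLam L M Λ'₀ Δ).cov b b')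
      (sandw L M Λ'₀ (cLoc (ldist (N := d) Mc) ρ (walkK L M Λ'₀ Δ γ Mc)))
      (fun X : Finset (Cubes Mc s (pbox M)) =>
        sandw L M Λ'₀ (cX (ldist (N := d) Mc) ρ (cubeOf Mc s) touch (walkK L M Λ'₀ Δ γ Mc) X)) := by
  classical
  intro b b'
  have h := eq245_lattice hγ (cA_nonneg d L hγ.le hc δ₀) hδ (hyp56_opA hL hLM hγ.le hc hδ.le hs hd hl hbox) hM5 hMR hMθ
    (ldist (N := d) Mc) ρ (cubeOf Mc s) touch
  dsimp only
  rw [cov_eq_sandw_inv hL hLM hγ hs hd hl, ← sandw_sum, ← sandw_add]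
  unfold sandw
  refine Finset.sum_congr rfl fun k' _ => ?_
  congr 1
  refine Finset.sum_congr rfl fun k _ => ?_
  rw [h k k']
  rfl

/-! ### The «similar estimates» -/

/-- kernel: exponent bookkeeping — on remaining variables in half-torus position p13's label-unit site distance `sdist = |·−·|_{ℤ^d}/M_c` is
the torus distance over `M_c`. [cite: BalabanImbrieJaffe1988, (2.41) p.264] -/
theorem exp_sdist_eq (hbox : HalfBox L M Λ'₀) (a : ℝ) (Mc : ℕ) (k k' : ↥(lamFree L M Λ'₀)) :
    Real.exp (-a * sdist (N := d) Mc (k : B4.Idx (pbox M) d) (k' : B4.Idx (pbox M) d)) =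
      Real.exp (-(a / Mc * pdist M (one_le_M M) ((k : B4.Idx (pbox M) d).1 : Fin d → ℤ) ((k' : B4.Idx (pbox M) d).1 : Fin d → ℤ))) := by
  rw [sdist, pdist_eq_dist_of_halfBox hbox k k']
  congr 1
  ring

/-- **THE LOCAL PART «is bounded as in (2.41)»** (the (2.43)-clause, gauge-field analog): `|C^{(k)}_{Λ,loc}(b, b′)| ≤
K₁e^{2δ′(L−1)}(L^d+1)²·e^{−δ′ρ_M(b,b′)}` with `K₁ = 2^dγ^{−1}(1−θ_W)^{−1}e^{δ₀/4}`, `δ′ = δ₀/(8M_c)`, `ρ_M` the TORUS distance (lattice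
units) — p13's `abs_cLoc_lattice_le` on `A`, sandwiched; also needs `θ_W < 1`. [cite: BalabanImbrieJaffe1988, (2.43) p.264, (2.49) p.265] -/
theorem abs_gLoc_le (hL : 0 < L) (hLM : ∀ i, L ∣ M i) (hγ : 0 < γ) (hc : 0 ≤ c₀) (hδ : 0 < δ₀) (hs : Δ.IsSymm)
    (hd : ∀ p q : B4.Idx (pbox M) d,
      |Δ p q| ≤ c₀ * Real.exp (-(δ₀ * pdist M (one_le_M M) (p.1 : Fin d → ℤ) (q.1 : Fin d → ℤ))))
    (hl : LowerOnConstrainedT L M Δ γ) (hbox : HalfBox L M Λ'₀) {Mc : ℕ} (hM5 : 5 ≤ Mc)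
    (hMR : kR d d γ (cA d L γ c₀ δ₀) δ₀ < Mc) (hMθ : thetaConst d d γ (cA d L γ c₀ δ₀) δ₀ < Mc)
    (hθW : thetaW d d γ (cA d L γ c₀ δ₀) δ₀ Mc < 1) (ρ : ℝ) (b b' : B4.Idx (pbox M) d) :
    |sandw L M Λ'₀ (cLoc (ldist (N := d) Mc) ρ (walkK L M Λ'₀ Δ γ Mc)) b b'| ≤
      (2 ^ d * γ⁻¹ * (1 - thetaW d d γ (cA d L γ c₀ δ₀) δ₀ Mc)⁻¹ * Real.exp (δ₀ / 4)) *
        Real.exp (2 * (δ₀ / 8 / Mc) * ((L : ℝ) - 1)) * ((L : ℝ) ^ d + 1) * ((L : ℝ) ^ d + 1) *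
        Real.exp (-(δ₀ / 8 / Mc * pdist M (one_le_M M) (b.1 : Fin d → ℤ) (b'.1 : Fin d → ℤ))) := by
  have hA := hyp56_opA hL hLM hγ.le hc hδ.le hs hd hl hbox
  have hK : 0 ≤ 2 ^ d * γ⁻¹ * (1 - thetaW d d γ (cA d L γ c₀ δ₀) δ₀ Mc)⁻¹ * Real.exp (δ₀ / 4) := by
    have : 0 < 1 - thetaW d d γ (cA d L γ c₀ δ₀) δ₀ Mc := by linarith
    positivity
  refine abs_sandw_le_of_decay hL hLM hs hd hl hK (by positivity) (fun k k' => ?_) b b'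
  have h := abs_cLoc_lattice_le hγ (cA_nonneg d L hγ.le hc δ₀) hδ hA hM5 hMR hMθ hθW ρ
    (k : B4.Idx (pbox M) d) (k' : B4.Idx (pbox M) d)
  rw [exp_sdist_eq hbox] at h
  exact h

/-- **(2.41) FOR THE GAUGE-FIELD COVARIANCE BY THE WALK ROUTE** (*"with similar estimates"*; cf. [I] (4.3.5)/(7.2.3)): `|C^{(k)}_Λ(b, b′)| ≤
K₁e^{2δ′(L−1)}(L^d+1)²·e^{−δ′ρ_M(b,b′)}`, `K₁ = 2^dγ^{−1}(1−θ_W)^{−1}e^{δ₀/4}`, `δ′ = δ₀/(8M_c)` — the whole expansion summed (p13's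
`abs_inv_lattice_le` on `A`), sandwiched. [cite: BalabanImbrieJaffe1988, (2.41) p.264, (2.49) p.265] -/
theorem abs_cov_le_walk (hL : 0 < L) (hLM : ∀ i, L ∣ M i) (hγ : 0 < γ) (hc : 0 ≤ c₀) (hδ : 0 < δ₀) (hs : Δ.IsSymm)
    (hd : ∀ p q : B4.Idx (pbox M) d,
      |Δ p q| ≤ c₀ * Real.exp (-(δ₀ * pdist M (one_le_M M) (p.1 : Fin d → ℤ) (q.1 : Fin d → ℤ))))
    (hl : LowerOnConstrainedT L M Δ γ) (hbox : HalfBox L M Λ'₀) {Mc : ℕ} (hM5 : 5 ≤ Mc)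
    (hMR : kR d d γ (cA d L γ c₀ δ₀) δ₀ < Mc) (hMθ : thetaConst d d γ (cA d L γ c₀ δ₀) δ₀ < Mc)
    (hθW : thetaW d d γ (cA d L γ c₀ δ₀) δ₀ Mc < 1) (b b' : B4.Idx (pbox M) d) :
    |(bondReductionLam L M Λ'₀ Δ).cov b b'| ≤
      (2 ^ d * γ⁻¹ * (1 - thetaW d d γ (cA d L γ c₀ δ₀) δ₀ Mc)⁻¹ * Real.exp (δ₀ / 4)) *
        Real.exp (2 * (δ₀ / 8 / Mc) * ((L : ℝ) - 1)) * ((L : ℝ) ^ d + 1) * ((L : ℝ) ^ d + 1) *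
        Real.exp (-(δ₀ / 8 / Mc * pdist M (one_le_M M) (b.1 : Fin d → ℤ) (b'.1 : Fin d → ℤ))) := by
  have hA := hyp56_opA hL hLM hγ.le hc hδ.le hs hd hl hbox
  have hK : 0 ≤ 2 ^ d * γ⁻¹ * (1 - thetaW d d γ (cA d L γ c₀ δ₀) δ₀ Mc)⁻¹ * Real.exp (δ₀ / 4) := by
    have : 0 < 1 - thetaW d d γ (cA d L γ c₀ δ₀) δ₀ Mc := by linarith
    positivity
  rw [cov_eq_sandw_inv hL hLM hγ hs hd hl]
  refine abs_sandw_le_of_decay hL hLM hs hd hl hK (by positivity) (fun k k' => ?_) b b'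
  have h := abs_inv_lattice_le hγ (cA_nonneg d L hγ.le hc δ₀) hδ hA hM5 hMR hMθ hθW
    (k : B4.Idx (pbox M) d) (k' : B4.Idx (pbox M) d)
  rw [exp_sdist_eq hbox] at h
  exact h

omit [∀ μ, NeZero (M μ)] in
/-- kernel: a non-vanishing sandwich entry has a non-vanishing middle entry between remaining variables met by the two outer factors
(bookkeeping for the support clause of (2.46)). [cite: BalabanImbrieJaffe1988, (2.46) p.264] -/
theorem exists_of_sandw_ne_zero {K : B4.Idx (pbox M) d → B4.Idx (pbox M) d → ℝ} {b b' : B4.Idx (pbox M) d}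
    (h : sandw L M Λ'₀ K b b' ≠ 0) :
    ∃ k k' : ↥(lamFree L M Λ'₀), elimLam L M Λ'₀ b k ≠ 0 ∧ elimLam L M Λ'₀ b' k' ≠ 0 ∧ K k k' ≠ 0 := by
  by_contra hne
  push Not at hne
  apply h
  unfold sandw
  refine Finset.sum_eq_zero fun k' _ => ?_
  by_cases hb' : elimLam L M Λ'₀ b' k' = 0
  · rw [hb', mul_zero]
  · rw [Finset.sum_eq_zero fun k _ => ?_, zero_mul]
    by_cases hb : elimLam L M Λ'₀ b k = 0
    · rw [hb, zero_mul]
    · rw [hne k k' hb hb', mul_zero]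

/-- kernel, the located reading of the outer factors: `C_Λ(b, k) ≠ 0` forces `ρ_M(b, k) ≤ L − 1` (pv09's `elimT_range`: `C` is supported
within one block, in the torus distance). [cite: Balaban1984PropagatorsII, p.250 ("C is a short-ranged operator")] -/
theorem pdist_le_of_elimLam_ne_zero (hL : 0 < L) {b : B4.Idx (pbox M) d} {k : ↥(lamFree L M Λ'₀)} (h : elimLam L M Λ'₀ b k ≠ 0) :
    pdist M (one_le_M M) (b.1 : Fin d → ℤ) ((k : B4.Idx (pbox M) d).1 : Fin d → ℤ) ≤ (L : ℝ) - 1 :=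
  elimT_range hL b ⟨(k : B4.Idx (pbox M) d), lamFree_subset L M Λ'₀ k.2⟩ h

omit [∀ μ, NeZero (M μ)] in
/-- **(2.46) SUPPORT CLAUSE, gauge-field analog** (*"It vanishes unless both arguments are in X"*): `C^{(k)}_{Λ,X}(b, b′) ≠ 0` forces remaining
variables `k, k′` with `C_Λ(b,k) ≠ 0`, `C_Λ(b′,k′) ≠ 0` (so within torus distance `L − 1` of `b`, `b′`, `pdist_le_of_elimLam_ne_zero`) lying
in blocks whose cube closures are inside `X` (p13's `memX`; `BIJ88RandomWalk242.cX_support` with the end-point locality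
`BIJ88Ineq246Lattice.latticeCw_support` of the walk terms of `A`). [cite: BalabanImbrieJaffe1988, (2.46) p.264, (2.49) p.265] -/
theorem gX_support {Mc : ℕ} (hM0 : 0 < Mc) (ρ : ℝ) (s : ℕ) (X : Finset (Cubes Mc s (pbox M))) {b b' : B4.Idx (pbox M) d}
    (h : sandw L M Λ'₀ (cX (ldist (N := d) Mc) ρ (cubeOf Mc s) touch (walkK L M Λ'₀ Δ γ Mc) X) b b' ≠ 0) :
    ∃ k k' : ↥(lamFree L M Λ'₀), elimLam L M Λ'₀ b k ≠ 0 ∧ elimLam L M Λ'₀ b' k' ≠ 0 ∧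
      memX (fun (x : B4.Idx (pbox M) d) (l : ↥(labels Mc (pbox M))) => InBox Mc l.1 (x.1 : Fin d → ℤ)) (cubeOf Mc s) touch
        (k : B4.Idx (pbox M) d) X ∧
      memX (fun (x : B4.Idx (pbox M) d) (l : ↥(labels Mc (pbox M))) => InBox Mc l.1 (x.1 : Fin d → ℤ)) (cubeOf Mc s) touch
        (k' : B4.Idx (pbox M) d) X := by
  classical
  obtain ⟨k, k', hk, hk', hK⟩ := exists_of_sandw_ne_zero h
  refine ⟨k, k', hk, hk', ?_⟩
  by_contra hmem
  exact hK (cX_support (ldist (N := d) Mc) ρ (cubeOf Mc s) touch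
    (fun (x : B4.Idx (pbox M) d) (l : ↥(labels Mc (pbox M))) => InBox Mc l.1 (x.1 : Fin d → ℤ))
    (latticeCw_support hM0 (opA L M Λ'₀ Δ γ)) X _ _ hmem)

/-- **(2.46) BOUND, gauge-field analog, two constants** (*"|C^{(k)}_{Λ,X}(u; x₁, x₂)| ≦ e^{−cr(e_k)|X|}"*, `|X|` = number of `r(e_k)`-cubes):
`|C^{(k)}_{Λ,X}(b, b′)| ≤ (L^d+1)²K₀·e^{−(δ₀s/(64·9^d))|X|}`, `K₀ = 2^dγ^{−1}(1−θ_W)^{−1}e^{δ₀/8}` — p13's `abs_cX_lattice_le` on `A` (`ρ = s/4`),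
sandwiched. [cite: BalabanImbrieJaffe1988, (2.46) p.264, (2.49) p.265] -/
theorem abs_gX_le (hL : 0 < L) (hLM : ∀ i, L ∣ M i) (hγ : 0 < γ) (hc : 0 ≤ c₀) (hδ : 0 < δ₀) (hs : Δ.IsSymm)
    (hd : ∀ p q : B4.Idx (pbox M) d,
      |Δ p q| ≤ c₀ * Real.exp (-(δ₀ * pdist M (one_le_M M) (p.1 : Fin d → ℤ) (q.1 : Fin d → ℤ))))
    (hl : LowerOnConstrainedT L M Δ γ) (hbox : HalfBox L M Λ'₀) {Mc : ℕ} (hM5 : 5 ≤ Mc)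
    (hMR : kR d d γ (cA d L γ c₀ δ₀) δ₀ < Mc) (hMθ : thetaConst d d γ (cA d L γ c₀ δ₀) δ₀ < Mc)
    (hθW : thetaW d d γ (cA d L γ c₀ δ₀) δ₀ Mc < 1) {s : ℕ} (hs0 : 0 < s) (X : Finset (Cubes Mc s (pbox M))) (b b' : B4.Idx (pbox M) d) :
    |sandw L M Λ'₀ (cX (ldist (N := d) Mc) ((s : ℝ) / 4) (cubeOf Mc s) touch (walkK L M Λ'₀ Δ γ Mc) X) b b'| ≤
      ((L : ℝ) ^ d + 1) * ((L : ℝ) ^ d + 1) * (K0 d d γ (cA d L γ c₀ δ₀) δ₀ Mc * Real.exp (-(δ₀ * s / (64 * 9 ^ d) * X.card))) := by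
  have hA := hyp56_opA hL hLM hγ.le hc hδ.le hs hd hl hbox
  have hK0 : 0 ≤ K0 d d γ (cA d L γ c₀ δ₀) δ₀ Mc := by
    have : 0 < 1 - thetaW d d γ (cA d L γ c₀ δ₀) δ₀ Mc := by linarith
    unfold K0; positivity
  exact abs_sandw_le_of_bound hL (by positivity)
    (fun k k' => abs_cX_lattice_le hγ (cA_nonneg d L hγ.le hc δ₀) hδ hA hM5 hMR hMθ hθW hs0 X
      (k : B4.Idx (pbox M) d) (k' : B4.Idx (pbox M) d)) b b'

/-- **(2.46) AS THE TYPED ROW `BIJ88Sect2Statements.Ineq246` FOR THE GAUGE-FIELD COVARIANCE** — support clause with *"both arguments in X"* read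
«`b` (resp. `b′`) is coupled by `C_Λ` to a remaining variable of a block whose cube closure lies in `X`», and the printed ONE-constant bound
`e^{−c·s·|X|}`, `c = δ₀/(256·9^d)`, once `r(e_k)` (= `s` labels) is large enough to absorb the prefactors (`K₀ ≤ e^{(δ₀/(128·9^d))s}` as in p13,
`(L^d+1)² ≤ e^{(δ₀/(256·9^d))s}`; p. 260: `r(e_k) → ∞`). [cite: BalabanImbrieJaffe1988, (2.46) p.264, (2.49) p.265] -/
theorem ineq246_gX (hL : 0 < L) (hLM : ∀ i, L ∣ M i) (hγ : 0 < γ) (hc : 0 ≤ c₀) (hδ : 0 < δ₀) (hs : Δ.IsSymm)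
    (hd : ∀ p q : B4.Idx (pbox M) d,
      |Δ p q| ≤ c₀ * Real.exp (-(δ₀ * pdist M (one_le_M M) (p.1 : Fin d → ℤ) (q.1 : Fin d → ℤ))))
    (hl : LowerOnConstrainedT L M Δ γ) (hbox : HalfBox L M Λ'₀) {Mc : ℕ} (hM5 : 5 ≤ Mc)
    (hMR : kR d d γ (cA d L γ c₀ δ₀) δ₀ < Mc) (hMθ : thetaConst d d γ (cA d L γ c₀ δ₀) δ₀ < Mc)
    (hθW : thetaW d d γ (cA d L γ c₀ δ₀) δ₀ Mc < 1) {s : ℕ} (hs0 : 0 < s)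
    (hlarge : K0 d d γ (cA d L γ c₀ δ₀) δ₀ Mc ≤ Real.exp (δ₀ / (128 * 9 ^ d) * s))
    (hlargeL : ((L : ℝ) ^ d + 1) * ((L : ℝ) ^ d + 1) ≤ Real.exp (δ₀ / (256 * 9 ^ d) * s)) :
    BIJ88Sect2Statements.Ineq246 (fun X : Finset (Cubes Mc s (pbox M)) => X.card)
      (fun (b : B4.Idx (pbox M) d) (X : Finset (Cubes Mc s (pbox M))) => ∃ k : ↥(lamFree L M Λ'₀), elimLam L M Λ'₀ b k ≠ 0 ∧
        memX (fun (x : B4.Idx (pbox M) d) (l : ↥(labels Mc (pbox M))) => InBox Mc l.1 (x.1 : Fin d → ℤ)) (cubeOf Mc s) touch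
          (k : B4.Idx (pbox M) d) X)
      (fun X b b' => sandw L M Λ'₀ (cX (ldist (N := d) Mc) ((s : ℝ) / 4) (cubeOf Mc s) touch (walkK L M Λ'₀ Δ γ Mc) X) b b')
      (δ₀ / (256 * 9 ^ d)) s := by
  classical
  have hM0 : 0 < Mc := by omega
  refine ⟨fun X b b' hnot => ?_, fun X b b' => ?_⟩
  · dsimp only at hnot ⊢
    by_contra hne
    obtain ⟨k, k', hk, hk', hmk, hmk'⟩ := gX_support (Λ'₀ := Λ'₀) (Δ := Δ) (γ := γ) hM0 ((s : ℝ) / 4) s X hne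
    exact hnot ⟨⟨k, hk, hmk⟩, ⟨k', hk', hmk'⟩⟩
  · dsimp only
    have hb := abs_gX_le hL hLM hγ hc hδ hs hd hl hbox hM5 hMR hMθ hθW hs0 X b b'
    rcases Nat.eq_zero_or_pos X.card with h0 | hpos
    · -- `X = ∅` carries nothing: `memX _ ∅` is impossible
      have hX : X = ∅ := Finset.card_eq_zero.mp h0
      have hz : sandw L M Λ'₀ (cX (ldist (N := d) Mc) ((s : ℝ) / 4) (cubeOf Mc s) touch (walkK L M Λ'₀ Δ γ Mc) X) b b' = 0 := by
        by_contra hne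
        obtain ⟨k, k', -, -, ⟨j, -, hj⟩, -⟩ := gX_support (Λ'₀ := Λ'₀) (Δ := Δ) (γ := γ) hM0 ((s : ℝ) / 4) s X hne
        have hmem := hj (subset_closure touch {cubeOf Mc s j} (Finset.mem_singleton_self _))
        rw [hX] at hmem
        exact Finset.notMem_empty _ hmem
      rw [hz, abs_zero]
      positivity
    · refine hb.trans ?_
      have h1 : (1 : ℝ) ≤ X.card := by exact_mod_cast hpos
      have hK0 : 0 ≤ K0 d d γ (cA d L γ c₀ δ₀) δ₀ Mc := by
        have : 0 < 1 - thetaW d d γ (cA d L γ c₀ δ₀) δ₀ Mc := by linarith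
        unfold K0; positivity
      have hprod : ((L : ℝ) ^ d + 1) * ((L : ℝ) ^ d + 1) * K0 d d γ (cA d L γ c₀ δ₀) δ₀ Mc ≤
          Real.exp (δ₀ / (256 * 9 ^ d) * s) * Real.exp (δ₀ / (128 * 9 ^ d) * s) :=
        mul_le_mul hlargeL hlarge hK0 (by positivity)
      rw [← Real.exp_add] at hprod
      have h9 : (0 : ℝ) < 9 ^ d := by positivity
      have hs' : (0 : ℝ) < s := by exact_mod_cast hs0
      calc ((L : ℝ) ^ d + 1) * ((L : ℝ) ^ d + 1) * (K0 d d γ (cA d L γ c₀ δ₀) δ₀ Mc * Real.exp (-(δ₀ * s / (64 * 9 ^ d) * X.card)))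
          = (((L : ℝ) ^ d + 1) * ((L : ℝ) ^ d + 1) * K0 d d γ (cA d L γ c₀ δ₀) δ₀ Mc) *
              Real.exp (-(δ₀ * s / (64 * 9 ^ d) * X.card)) := by ring
        _ ≤ Real.exp (δ₀ / (256 * 9 ^ d) * s + δ₀ / (128 * 9 ^ d) * s) * Real.exp (-(δ₀ * s / (64 * 9 ^ d) * X.card)) :=
              mul_le_mul_of_nonneg_right hprod (by positivity)
        _ = Real.exp (δ₀ / (256 * 9 ^ d) * s + δ₀ / (128 * 9 ^ d) * s - δ₀ * s / (64 * 9 ^ d) * X.card) := by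
              rw [← Real.exp_add]; ring_nf
        _ ≤ Real.exp (-(δ₀ / (256 * 9 ^ d)) * s * X.card) := Real.exp_le_exp.2 (by
              have h2 : δ₀ / (256 * 9 ^ d) * s + δ₀ / (128 * 9 ^ d) * s ≤ (δ₀ / (256 * 9 ^ d) * s + δ₀ / (128 * 9 ^ d) * s) * X.card := by
                have h3 : 0 ≤ δ₀ / (256 * 9 ^ d) * s + δ₀ / (128 * 9 ^ d) * s := by positivity
                nlinarith
              have h4 : (δ₀ / (256 * 9 ^ d) * s + δ₀ / (128 * 9 ^ d) * s) * X.card - δ₀ * s / (64 * 9 ^ d) * X.card =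
                  -(δ₀ / (256 * 9 ^ d)) * s * X.card := by ring
              linarith)

/-- **(2.47), gauge-field analog, two constants** (*"|C^{(k)}_{Λ,loc} − C^{(k)}_Λ| ≦ e^{−cr(e_k)}e^{−c|x₁−x₂|}"* summed over `X`): the tail of the
primed sum, `|C^{(k)}_{Λ,loc}(b,b′) − C^{(k)}_Λ(b,b′)| ≤ (L^d+1)²·2^dγ^{−1}(1−θ_W)^{−1}e^{−(δ₀/8)(ρ−1)}` — p13's `abs_cLoc_sub_inv_le` on `A`,
sandwiched. [cite: BalabanImbrieJaffe1988, (2.47) p.265, (2.49) p.265] -/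
theorem abs_gLoc_sub_cov_le (hL : 0 < L) (hLM : ∀ i, L ∣ M i) (hγ : 0 < γ) (hc : 0 ≤ c₀) (hδ : 0 < δ₀) (hs : Δ.IsSymm)
    (hd : ∀ p q : B4.Idx (pbox M) d,
      |Δ p q| ≤ c₀ * Real.exp (-(δ₀ * pdist M (one_le_M M) (p.1 : Fin d → ℤ) (q.1 : Fin d → ℤ))))
    (hl : LowerOnConstrainedT L M Δ γ) (hbox : HalfBox L M Λ'₀) {Mc : ℕ} (hM5 : 5 ≤ Mc)
    (hMR : kR d d γ (cA d L γ c₀ δ₀) δ₀ < Mc) (hMθ : thetaConst d d γ (cA d L γ c₀ δ₀) δ₀ < Mc)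
    (hθW : thetaW d d γ (cA d L γ c₀ δ₀) δ₀ Mc < 1) (ρ : ℝ) (b b' : B4.Idx (pbox M) d) :
    |sandw L M Λ'₀ (cLoc (ldist (N := d) Mc) ρ (walkK L M Λ'₀ Δ γ Mc)) b b' - (bondReductionLam L M Λ'₀ Δ).cov b b'| ≤
      ((L : ℝ) ^ d + 1) * ((L : ℝ) ^ d + 1) *
        (2 ^ d * γ⁻¹ * (1 - thetaW d d γ (cA d L γ c₀ δ₀) δ₀ Mc)⁻¹ * Real.exp (-(δ₀ / 8 * (ρ - 1)))) := by
  have hA := hyp56_opA hL hLM hγ.le hc hδ.le hs hd hl hbox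
  have hK : 0 ≤ 2 ^ d * γ⁻¹ * (1 - thetaW d d γ (cA d L γ c₀ δ₀) δ₀ Mc)⁻¹ * Real.exp (-(δ₀ / 8 * (ρ - 1))) := by
    have : 0 < 1 - thetaW d d γ (cA d L γ c₀ δ₀) δ₀ Mc := by linarith
    positivity
  rw [cov_eq_sandw_inv hL hLM hγ hs hd hl, ← sandw_sub]
  exact abs_sandw_le_of_bound hL hK
    (fun k k' => abs_cLoc_sub_inv_le hγ (cA_nonneg d L hγ.le hc δ₀) hδ hA hM5 hMR hMθ hθW ρ
      (k : B4.Idx (pbox M) d) (k' : B4.Idx (pbox M) d)) b b'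

/-- **(2.47) AS THE TYPED ROW `BIJ88Sect2Statements.Close` FOR THE GAUGE-FIELD COVARIANCE, IN THE TORUS DISTANCE** (with the printed
`e^{−c|x₁−x₂|}` factor): `Close ρ_M C^{(k)}_{Λ,loc} C^{(k)}_Λ δ c`, `c = δ₀/(16M_c)`, `δ = 2^dγ^{−1}(1−θ_W)^{−1}e^{−(δ₀/16)(ρ−3)}·e^{2c(L−1)}(L^d+1)²` —
p13's `close247_lattice` on `A`, sandwiched through §1. [cite: BalabanImbrieJaffe1988, (2.47) p.265, (2.49) p.265] -/
theorem close247_gauge (hL : 0 < L) (hLM : ∀ i, L ∣ M i) (hγ : 0 < γ) (hc : 0 ≤ c₀) (hδ : 0 < δ₀) (hs : Δ.IsSymm)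
    (hd : ∀ p q : B4.Idx (pbox M) d,
      |Δ p q| ≤ c₀ * Real.exp (-(δ₀ * pdist M (one_le_M M) (p.1 : Fin d → ℤ) (q.1 : Fin d → ℤ))))
    (hl : LowerOnConstrainedT L M Δ γ) (hbox : HalfBox L M Λ'₀) {Mc : ℕ} (hM5 : 5 ≤ Mc)
    (hMR : kR d d γ (cA d L γ c₀ δ₀) δ₀ < Mc) (hMθ : thetaConst d d γ (cA d L γ c₀ δ₀) δ₀ < Mc)
    (hθW : thetaW d d γ (cA d L γ c₀ δ₀) δ₀ Mc < 1) (ρ : ℝ) :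
    BIJ88Sect2Statements.Close (fun b b' : B4.Idx (pbox M) d => pdist M (one_le_M M) (b.1 : Fin d → ℤ) (b'.1 : Fin d → ℤ))
      (sandw L M Λ'₀ (cLoc (ldist (N := d) Mc) ρ (walkK L M Λ'₀ Δ γ Mc)))
      (fun b b' => (bondReductionLam L M Λ'₀ Δ).cov b b')
      ((2 ^ d * γ⁻¹ * (1 - thetaW d d γ (cA d L γ c₀ δ₀) δ₀ Mc)⁻¹ * Real.exp (-(δ₀ / 16 * (ρ - 3)))) *
        Real.exp (2 * (δ₀ / 16 / Mc) * ((L : ℝ) - 1)) * ((L : ℝ) ^ d + 1) * ((L : ℝ) ^ d + 1)) (δ₀ / 16 / Mc) := by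
  intro b b'
  have hA := hyp56_opA hL hLM hγ.le hc hδ.le hs hd hl hbox
  have hK : 0 ≤ 2 ^ d * γ⁻¹ * (1 - thetaW d d γ (cA d L γ c₀ δ₀) δ₀ Mc)⁻¹ * Real.exp (-(δ₀ / 16 * (ρ - 3))) := by
    have : 0 < 1 - thetaW d d γ (cA d L γ c₀ δ₀) δ₀ Mc := by linarith
    positivity
  dsimp only
  rw [cov_eq_sandw_inv hL hLM hγ hs hd hl, ← sandw_sub, neg_mul]
  refine abs_sandw_le_of_decay hL hLM hs hd hl hK (by positivity) (fun k k' => ?_) b b'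
  have h := close247_lattice hγ (cA_nonneg d L hγ.le hc δ₀) hδ hA hM5 hMR hMθ hθW ρ (k : B4.Idx (pbox M) d) (k' : B4.Idx (pbox M) d)
  dsimp only at h
  rw [exp_sdist_eq hbox] at h
  exact h

/-! ## §5 A sufficient condition for the half-torus position -/

omit [∀ μ, NeZero (M μ)] in
/-- kernel (dictionary): if every `Λ`-bond variable (pv09's `IsLam`: a torus bond with an end-point in `Λ = B(Λ′₀)`), read in the box, lies in a
coordinate window `[lo_μ, lo_μ + w_μ]` with `2w_μ ≤ M_μ`, then `Λ` is in half-torus position. [cite: BalabanImbrieJaffe1988, (2.49) p.265] -/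
theorem halfBox_of_window (lo : Fin d → ℤ) (w : Fin d → ℕ) (hw : ∀ i, 2 * (w i : ℤ) ≤ (M i : ℤ))
    (hΛ : ∀ p : B4.Idx (pbox M) d, IsLam L M Λ'₀ p → ∀ i, lo i ≤ (p.1 : Fin d → ℤ) i ∧ (p.1 : Fin d → ℤ) i ≤ lo i + w i) :
    HalfBox L M Λ'₀ := by
  intro k hk k' hk' i
  have h1 := hΛ k ((mem_lamFree.1 hk).2) i
  have h2 := hΛ k' ((mem_lamFree.1 hk').2) i
  have h3 : |(k.1 : Fin d → ℤ) i - (k'.1 : Fin d → ℤ) i| ≤ (w i : ℤ) := abs_sub_le_iff.2 ⟨by omega, by omega⟩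
  linarith [hw i]

/-! ## §6 THE INSTANCE: THE GENUINE `Δ_k` OF [6I] (1.65) = [I] (4.3.1) — constants from `(d, L)` only -/

/-- **[6] (5.6) FOR THE [6]-OPERATOR OF THE GENUINE GAUGE-FIELD COVARIANCE**, hypothesis-free: with the kernel decay `(c₀, δ₀)` of `Δ_k`
(pv09's `kernelDecay_reDelK`, depending on `d` only) and the (2.153) constant `γ′ = (1/12d²)L^{−d−1}` (`lowerOnConstrainedT_reDelK_sharp`), for every
torus (`L ∣ M_μ`), every level `n ≥ 1` and every `Λ = B(Λ′₀)` in half-torus position, `A = pad(C_Λ*(Re Δ_k)C_Λ)` satisfies `B4.Hyp56` with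
`(γ′, c₀e^{2δ₀(L−1)}(L^d+1)² + γ′, δ₀)` — constants depending on `(d, L)` ONLY (*"M = O(1)"*, p. 264).
[cite: BalabanImbrieJaffe1988, (2.49) p.265; Balaban1984PropagatorsII, (2.153)–(2.157) pp.249–250] -/
theorem hyp56_opA_DelK (hd2 : 2 ≤ d) (hL : 1 ≤ L) :
    ∃ c₀ δ₀ : ℝ, 0 < c₀ ∧ 0 < δ₀ ∧ ∀ (M : Fin d → ℕ) [∀ μ, NeZero (M μ)], (∀ i, L ∣ M i) → ∀ (n : ℕ) (hn : 1 ≤ n)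
      (Λ'₀ : Finset (Fin d → ℤ)), HalfBox L M Λ'₀ →
      B4.Hyp56 (pbox M) (opA L M Λ'₀ (reDelK n hn M) (gamma2153one d L)) (gamma2153one d L)
        (cA d L (gamma2153one d L) c₀ δ₀) δ₀ := by
  obtain ⟨c₀, δ₀, hc, hδ, hK⟩ := kernelDecay_reDelK (d := d) (by omega)
  exact ⟨c₀, δ₀, hc, hδ, fun M _ hLM n hn Λ'₀ hbox =>
    hyp56_opA (by omega) hLM (gamma2153one_pos (by omega) hL).le hc.le hδ.le (reDelK_isSymm n hn M) (hK M n hn)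
      (lowerOnConstrainedT_reDelK_sharp hd2 hL n hn hLM) hbox⟩

/-- **THE RANDOM WALK EXPANSION OF THE GENUINE GAUGE-FIELD COVARIANCE `C^{(k)}_Λ = C_Λ(C_Λ*Δ_kC_Λ)⁻¹C_Λ*`** ([6II] (2.156), the genuine `Δ_k`):
there are `c₀, δ₀ > 0` (from `d`) such that for every torus, level, `Λ` in half-torus position and cubes `M_c ≥ 5`, `M_c > K_R`, `M_c > Θ₁`
(thresholds from `(d, L)` only): `C^{(k)}_Λ(b,b′) = Σ_ω (C_Λ C_ω C_Λᵀ)(b,b′)` unconditionally. [cite: BalabanImbrieJaffe1988, (2.42) p.264, (2.49) p.265] -/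
theorem hasSum_walk_cov_DelK (hd2 : 2 ≤ d) (hL : 1 ≤ L) :
    ∃ c₀ δ₀ : ℝ, 0 < c₀ ∧ 0 < δ₀ ∧ ∀ (M : Fin d → ℕ) [∀ μ, NeZero (M μ)], (∀ i, L ∣ M i) → ∀ (n : ℕ) (hn : 1 ≤ n)
      (Λ'₀ : Finset (Fin d → ℤ)), HalfBox L M Λ'₀ → ∀ (Mc : ℕ), 5 ≤ Mc →
      kR d d (gamma2153one d L) (cA d L (gamma2153one d L) c₀ δ₀) δ₀ < Mc →
      thetaConst d d (gamma2153one d L) (cA d L (gamma2153one d L) c₀ δ₀) δ₀ < Mc → ∀ b b' : B4.Idx (pbox M) d,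
      HasSum (fun ω => sandw L M Λ'₀ (walkK L M Λ'₀ (reDelK n hn M) (gamma2153one d L) Mc ω) b b')
        ((bondReductionLam L M Λ'₀ (reDelK n hn M)).cov b b') := by
  obtain ⟨c₀, δ₀, hc, hδ, hK⟩ := kernelDecay_reDelK (d := d) (by omega)
  exact ⟨c₀, δ₀, hc, hδ, fun M _ hLM n hn Λ'₀ hbox Mc hM5 hMR hMθ b b' =>
    hasSum_walk_cov (by omega) hLM (gamma2153one_pos (by omega) hL) hc.le hδ (reDelK_isSymm n hn M) (hK M n hn)
      (lowerOnConstrainedT_reDelK_sharp hd2 hL n hn hLM) hbox hM5 hMR hMθ b b'⟩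

/-- **(2.49) FOR THE GENUINE GAUGE-FIELD COVARIANCE, HYPOTHESIS-FREE BUT FOR GEOMETRY** — p. 265: *"the single-step covariance for the gauge
field can be given a random walk expansion analogous to (2.45), with similar estimates: C^{(k)}_Λ = C^{(k)}_{Λ,loc} + Σ_X C^{(k)}_{Λ,X} (2.49)"*:
there are `c₀, δ₀ > 0` (from `d`) such that for every torus (`L ∣ M_μ`, `d ≥ 2`, `L ≥ 1`), every level `n ≥ 1`, every `Λ = B(Λ′₀)` in
half-torus position, cubes `M_c ≥ 5`, `M_c > K_R(d,L)`, `M_c > Θ₁(d,L)`, and every `ρ`, `s`: the typed row `BIJ88Sect2Statements.Eq245` holds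
for `C^{(k)}_Λ = C_Λ(C_Λ*(Re Δ_k)C_Λ)⁻¹C_Λ*` of [6II] (2.156) — `Δ_k` the genuine (1.65) operator = the (4.3.1) curl action of [I] on the torus
(p09's `BIJ85Eq431DeltaKBridge`/`DeltaK_eq_submatrix`) — with `C^{(k)}_{Λ,loc} = C_Λ·C_{loc}[A]·C_Λᵀ`, `C^{(k)}_{Λ,X} = C_Λ·C_X[A]·C_Λᵀ`.
[cite: BalabanImbrieJaffe1988, (2.49) p.265; Balaban1984PropagatorsII, (2.156) p.250] -/
theorem eq249_DelK (hd2 : 2 ≤ d) (hL : 1 ≤ L) :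
    ∃ c₀ δ₀ : ℝ, 0 < c₀ ∧ 0 < δ₀ ∧ ∀ (M : Fin d → ℕ) [∀ μ, NeZero (M μ)], (∀ i, L ∣ M i) → ∀ (n : ℕ) (hn : 1 ≤ n)
      (Λ'₀ : Finset (Fin d → ℤ)), HalfBox L M Λ'₀ → ∀ (Mc : ℕ), 5 ≤ Mc →
      kR d d (gamma2153one d L) (cA d L (gamma2153one d L) c₀ δ₀) δ₀ < Mc →
      thetaConst d d (gamma2153one d L) (cA d L (gamma2153one d L) c₀ δ₀) δ₀ < Mc → ∀ (ρ : ℝ) (s : ℕ),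
      BIJ88Sect2Statements.Eq245 (fun b b' : B4.Idx (pbox M) d => (bondReductionLam L M Λ'₀ (reDelK n hn M)).cov b b')
        (sandw L M Λ'₀ (cLoc (ldist (N := d) Mc) ρ (walkK L M Λ'₀ (reDelK n hn M) (gamma2153one d L) Mc)))
        (fun X : Finset (Cubes Mc s (pbox M)) =>
          sandw L M Λ'₀ (cX (ldist (N := d) Mc) ρ (cubeOf Mc s) touch (walkK L M Λ'₀ (reDelK n hn M) (gamma2153one d L) Mc) X)) := by
  obtain ⟨c₀, δ₀, hc, hδ, hK⟩ := kernelDecay_reDelK (d := d) (by omega)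
  exact ⟨c₀, δ₀, hc, hδ, fun M _ hLM n hn Λ'₀ hbox Mc hM5 hMR hMθ ρ s =>
    eq249 (by omega) hLM (gamma2153one_pos (by omega) hL) hc.le hδ (reDelK_isSymm n hn M) (hK M n hn)
      (lowerOnConstrainedT_reDelK_sharp hd2 hL n hn hLM) hbox hM5 hMR hMθ ρ s⟩

/-- **(2.41)/(4.3.5)-SHAPE DECAY OF THE GENUINE `C^{(k)}_Λ` ON SUB-REGIONS BY THE WALK ROUTE** (*"with similar estimates"*): there are `c₀, δ₀ > 0`
(from `d`) such that, for every torus, level, `Λ` in half-torus position and cubes above the `(d, L)`-thresholds with `θ_W < 1`,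
`|C^{(k)}_Λ(b,b′)| ≤ K₁e^{2δ′(L−1)}(L^d+1)²e^{−δ′ρ_M(b,b′)}`, `δ′ = δ₀/(8M_c)`, `K₁ = 2^dγ′^{−1}(1−θ_W)^{−1}e^{δ₀/4}`, `ρ_M` the torus distance.
[cite: BalabanImbrieJaffe1988, (2.41) p.264, (2.49) p.265; BalabanImbrieJaffe1985, (4.3.5) p.311] -/
theorem abs_cov_le_walk_DelK (hd2 : 2 ≤ d) (hL : 1 ≤ L) :
    ∃ c₀ δ₀ : ℝ, 0 < c₀ ∧ 0 < δ₀ ∧ ∀ (M : Fin d → ℕ) [∀ μ, NeZero (M μ)], (∀ i, L ∣ M i) → ∀ (n : ℕ) (hn : 1 ≤ n)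
      (Λ'₀ : Finset (Fin d → ℤ)), HalfBox L M Λ'₀ → ∀ (Mc : ℕ), 5 ≤ Mc →
      kR d d (gamma2153one d L) (cA d L (gamma2153one d L) c₀ δ₀) δ₀ < Mc →
      thetaConst d d (gamma2153one d L) (cA d L (gamma2153one d L) c₀ δ₀) δ₀ < Mc →
      thetaW d d (gamma2153one d L) (cA d L (gamma2153one d L) c₀ δ₀) δ₀ Mc < 1 → ∀ b b' : B4.Idx (pbox M) d,
      |(bondReductionLam L M Λ'₀ (reDelK n hn M)).cov b b'| ≤
        (2 ^ d * (gamma2153one d L)⁻¹ * (1 - thetaW d d (gamma2153one d L) (cA d L (gamma2153one d L) c₀ δ₀) δ₀ Mc)⁻¹ *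
            Real.exp (δ₀ / 4)) *
          Real.exp (2 * (δ₀ / 8 / Mc) * ((L : ℝ) - 1)) * ((L : ℝ) ^ d + 1) * ((L : ℝ) ^ d + 1) *
          Real.exp (-(δ₀ / 8 / Mc * pdist M (one_le_M M) (b.1 : Fin d → ℤ) (b'.1 : Fin d → ℤ))) := by
  obtain ⟨c₀, δ₀, hc, hδ, hK⟩ := kernelDecay_reDelK (d := d) (by omega)
  exact ⟨c₀, δ₀, hc, hδ, fun M _ hLM n hn Λ'₀ hbox Mc hM5 hMR hMθ hθW b b' =>
    abs_cov_le_walk (by omega) hLM (gamma2153one_pos (by omega) hL) hc.le hδ (reDelK_isSymm n hn M) (hK M n hn)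
      (lowerOnConstrainedT_reDelK_sharp hd2 hL n hn hLM) hbox hM5 hMR hMθ hθW b b'⟩

/-- **(2.46) TYPED, FOR THE GENUINE GAUGE-FIELD COVARIANCE**: there are `c₀, δ₀ > 0` (from `d`) such that for every torus, level, `Λ` in
half-torus position, cubes above the `(d, L)`-thresholds with `θ_W < 1`, and `r(e_k)`-cubes of `s > 0` labels large enough (`K₀ ≤ e^{(δ₀/(128·9^d))s}`,
`(L^d+1)² ≤ e^{(δ₀/(256·9^d))s}`), `BIJ88Sect2Statements.Ineq246` holds for the `X`-parts `C^{(k)}_{Λ,X} = C_Λ·C_X[A]·C_Λᵀ` with `c = δ₀/(256·9^d)`.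
[cite: BalabanImbrieJaffe1988, (2.46) p.264, (2.49) p.265] -/
theorem ineq246_gX_DelK (hd2 : 2 ≤ d) (hL : 1 ≤ L) :
    ∃ c₀ δ₀ : ℝ, 0 < c₀ ∧ 0 < δ₀ ∧ ∀ (M : Fin d → ℕ) [∀ μ, NeZero (M μ)], (∀ i, L ∣ M i) → ∀ (n : ℕ) (hn : 1 ≤ n)
      (Λ'₀ : Finset (Fin d → ℤ)), HalfBox L M Λ'₀ → ∀ (Mc : ℕ), 5 ≤ Mc →
      kR d d (gamma2153one d L) (cA d L (gamma2153one d L) c₀ δ₀) δ₀ < Mc →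
      thetaConst d d (gamma2153one d L) (cA d L (gamma2153one d L) c₀ δ₀) δ₀ < Mc →
      thetaW d d (gamma2153one d L) (cA d L (gamma2153one d L) c₀ δ₀) δ₀ Mc < 1 → ∀ (s : ℕ), 0 < s →
      K0 d d (gamma2153one d L) (cA d L (gamma2153one d L) c₀ δ₀) δ₀ Mc ≤ Real.exp (δ₀ / (128 * 9 ^ d) * s) →
      ((L : ℝ) ^ d + 1) * ((L : ℝ) ^ d + 1) ≤ Real.exp (δ₀ / (256 * 9 ^ d) * s) →
      BIJ88Sect2Statements.Ineq246 (fun X : Finset (Cubes Mc s (pbox M)) => X.card)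
        (fun (b : B4.Idx (pbox M) d) (X : Finset (Cubes Mc s (pbox M))) => ∃ k : ↥(lamFree L M Λ'₀), elimLam L M Λ'₀ b k ≠ 0 ∧
          memX (fun (x : B4.Idx (pbox M) d) (l : ↥(labels Mc (pbox M))) => InBox Mc l.1 (x.1 : Fin d → ℤ)) (cubeOf Mc s) touch
            (k : B4.Idx (pbox M) d) X)
        (fun X b b' => sandw L M Λ'₀ (cX (ldist (N := d) Mc) ((s : ℝ) / 4) (cubeOf Mc s) touch
          (walkK L M Λ'₀ (reDelK n hn M) (gamma2153one d L) Mc) X) b b')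
        (δ₀ / (256 * 9 ^ d)) s := by
  obtain ⟨c₀, δ₀, hc, hδ, hK⟩ := kernelDecay_reDelK (d := d) (by omega)
  exact ⟨c₀, δ₀, hc, hδ, fun M _ hLM n hn Λ'₀ hbox Mc hM5 hMR hMθ hθW s hs0 hlarge hlargeL =>
    ineq246_gX (by omega) hLM (gamma2153one_pos (by omega) hL) hc.le hδ (reDelK_isSymm n hn M) (hK M n hn)
      (lowerOnConstrainedT_reDelK_sharp hd2 hL n hn hLM) hbox hM5 hMR hMθ hθW hs0 hlarge hlargeL⟩

/-- **(2.47) TYPED (`Close`, torus distance) FOR THE GENUINE GAUGE-FIELD COVARIANCE**: there are `c₀, δ₀ > 0` (from `d`) such that for every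
torus, level, `Λ` in half-torus position, cubes above the `(d, L)`-thresholds with `θ_W < 1`, and every `ρ`:
`|C^{(k)}_{Λ,loc}(b,b′) − C^{(k)}_Λ(b,b′)| ≤ δe^{−cρ_M(b,b′)}`, `c = δ₀/(16M_c)`, `δ = 2^dγ′^{−1}(1−θ_W)^{−1}e^{−(δ₀/16)(ρ−3)}e^{2c(L−1)}(L^d+1)²`.
[cite: BalabanImbrieJaffe1988, (2.47) p.265, (2.49) p.265] -/
theorem close247_gauge_DelK (hd2 : 2 ≤ d) (hL : 1 ≤ L) :
    ∃ c₀ δ₀ : ℝ, 0 < c₀ ∧ 0 < δ₀ ∧ ∀ (M : Fin d → ℕ) [∀ μ, NeZero (M μ)], (∀ i, L ∣ M i) → ∀ (n : ℕ) (hn : 1 ≤ n)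
      (Λ'₀ : Finset (Fin d → ℤ)), HalfBox L M Λ'₀ → ∀ (Mc : ℕ), 5 ≤ Mc →
      kR d d (gamma2153one d L) (cA d L (gamma2153one d L) c₀ δ₀) δ₀ < Mc →
      thetaConst d d (gamma2153one d L) (cA d L (gamma2153one d L) c₀ δ₀) δ₀ < Mc →
      thetaW d d (gamma2153one d L) (cA d L (gamma2153one d L) c₀ δ₀) δ₀ Mc < 1 → ∀ (ρ : ℝ),
      BIJ88Sect2Statements.Close (fun b b' : B4.Idx (pbox M) d => pdist M (one_le_M M) (b.1 : Fin d → ℤ) (b'.1 : Fin d → ℤ))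
        (sandw L M Λ'₀ (cLoc (ldist (N := d) Mc) ρ (walkK L M Λ'₀ (reDelK n hn M) (gamma2153one d L) Mc)))
        (fun b b' => (bondReductionLam L M Λ'₀ (reDelK n hn M)).cov b b')
        ((2 ^ d * (gamma2153one d L)⁻¹ * (1 - thetaW d d (gamma2153one d L) (cA d L (gamma2153one d L) c₀ δ₀) δ₀ Mc)⁻¹ *
            Real.exp (-(δ₀ / 16 * (ρ - 3)))) *
          Real.exp (2 * (δ₀ / 16 / Mc) * ((L : ℝ) - 1)) * ((L : ℝ) ^ d + 1) * ((L : ℝ) ^ d + 1)) (δ₀ / 16 / Mc) := by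
  obtain ⟨c₀, δ₀, hc, hδ, hK⟩ := kernelDecay_reDelK (d := d) (by omega)
  exact ⟨c₀, δ₀, hc, hδ, fun M _ hLM n hn Λ'₀ hbox Mc hM5 hMR hMθ hθW ρ =>
    close247_gauge (by omega) hLM (gamma2153one_pos (by omega) hL) hc.le hδ (reDelK_isSymm n hn M) (hK M n hn)
      (lowerOnConstrainedT_reDelK_sharp hd2 hL n hn hLM) hbox hM5 hMR hMθ hθW ρ⟩

/-! ## §7 IN THE VOCABULARY OF [I] (the tori `Params` of the series, scale `k`, p09's dictionary `idx`) -/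

section BIJ85

open BIJ85Ineq723TorusCornerGauge (idx idx_fst_coe L_dvd_Mk)
open BIJ85Eq431DeltaKBridge (one_le_Lpow pdist_rep_eq_supDist)
open B5Eq117TorusCarriers (Mk)
open LatticeFieldCalculus (supDist)

/-- **(2.49) ON THE TORI OF THE SERIES, FOR THE Λ-COVARIANCE OF THE (4.3.1) ACTION OF [I] IN BAŁABAN'S AXIAL GAUGE** ([6II] (2.154)/(2.156):
`B = 0` outside `Λ = B(Λ′₀)`, `δ(QB)` at the coarse bonds meeting `Λ′₀`, `δ_{Ax}` on the blocks of `Λ′₀`; the whole-torus member of this family is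
the (4.3.3) propagator of [I] by p09's `kernel_corner_eq_cov`): for `d ≥ 2` and `L` there are `c₀, δ₀ > 0` such that for every torus `Setup` with
these `(d, L)`, every scale `k + 1 ≤ m + K`, every `Λ′₀` in half-torus position on `T₁^{(k)}`, cubes `M_c ≥ 5`, `M_c > K_R(d,L)`, `M_c > Θ₁(d,L)`,
every `ρ`, `s`: `Eq245` for `C^{(k)}_Λ(b, b′)` (bonds `b, b′` of `T₁^{(k)}` read through `idx`). [cite: BalabanImbrieJaffe1988, (2.49) p.265;
BalabanImbrieJaffe1985, (4.3.1)–(4.3.3) p.311; Balaban1984PropagatorsII, (2.154)–(2.156) pp.249–250] -/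
theorem eq249_torus (d L : ℕ) (hd2 : 2 ≤ d) (hL : 1 ≤ L) :
    ∃ c₀ δ₀ : ℝ, 0 < c₀ ∧ 0 < δ₀ ∧ ∀ (P : Params), P.d = d → P.L = L → ∀ (k : ℕ) (hk : k + 1 ≤ P.m + P.K)
      (Λ'₀ : Finset (Fin P.d → ℤ)), HalfBox P.L (Mk P k) Λ'₀ → ∀ (Mc : ℕ), 5 ≤ Mc →
      kR P.d P.d (gamma2153one P.d P.L) (cA P.d P.L (gamma2153one P.d P.L) c₀ δ₀) δ₀ < Mc →
      thetaConst P.d P.d (gamma2153one P.d P.L) (cA P.d P.L (gamma2153one P.d P.L) c₀ δ₀) δ₀ < Mc → ∀ (ρ : ℝ) (s : ℕ),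
      BIJ88Sect2Statements.Eq245
        (fun b b' : PBond P k => (bondReductionLam P.L (Mk P k) Λ'₀ (reDelK (P.L ^ k) (one_le_Lpow P k) (Mk P k))).cov (idx P k b) (idx P k b'))
        (fun b b' => sandw P.L (Mk P k) Λ'₀ (cLoc (ldist (N := P.d) Mc) ρ
          (walkK P.L (Mk P k) Λ'₀ (reDelK (P.L ^ k) (one_le_Lpow P k) (Mk P k)) (gamma2153one P.d P.L) Mc)) (idx P k b) (idx P k b'))
        (fun (X : Finset (Cubes Mc s (pbox (Mk P k)))) b b' => sandw P.L (Mk P k) Λ'₀ (cX (ldist (N := P.d) Mc) ρ (cubeOf Mc s) touch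
          (walkK P.L (Mk P k) Λ'₀ (reDelK (P.L ^ k) (one_le_Lpow P k) (Mk P k)) (gamma2153one P.d P.L) Mc) X) (idx P k b) (idx P k b')) := by
  obtain ⟨c₀, δ₀, hc, hδ, H⟩ := eq249_DelK (d := d) (L := L) hd2 hL
  refine ⟨c₀, δ₀, hc, hδ, fun P hPd hPL k hk Λ'₀ hbox Mc hM5 hMR hMθ ρ s b b' => ?_⟩
  subst hPd hPL
  exact H (Mk P k) (L_dvd_Mk hk) (P.L ^ k) (one_le_Lpow P k) Λ'₀ hbox Mc hM5 hMR hMθ ρ s (idx P k b) (idx P k b')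

/-- **(2.41)/(4.3.5)/(7.2.3)-SHAPE DECAY OF THE Λ-COVARIANCE ON THE TORI OF THE SERIES, BY THE WALK ROUTE, IN THE TORUS DISTANCE OF `T₁^{(k)}`**:
for `d ≥ 2`, `L`, there are `c₀, δ₀ > 0` with `|C^{(k)}_Λ(b, b′)| ≤ K₁e^{2δ′(L−1)}(L^d+1)²·e^{−δ′|b₋ − b′₋|}` (`|·|` = `supDist`, `δ′ = δ₀/(8M_c)`,
`K₁ = 2^dγ′^{−1}(1−θ_W)^{−1}e^{δ₀/4}`) for every torus `Setup` with these `(d, L)`, every `k + 1 ≤ m + K`, `Λ′₀` in half-torus position and cubes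
above the `(d, L)`-thresholds (cf. p09's `ineq723_corner` for the whole-torus propagator by the Combes–Thomas route).
[cite: BalabanImbrieJaffe1988, (2.41) p.264, (2.49) p.265; BalabanImbrieJaffe1985, (7.2.3) p.325] -/
theorem abs_covLam_le_torus (d L : ℕ) (hd2 : 2 ≤ d) (hL : 1 ≤ L) :
    ∃ c₀ δ₀ : ℝ, 0 < c₀ ∧ 0 < δ₀ ∧ ∀ (P : Params), P.d = d → P.L = L → ∀ (k : ℕ) (hk : k + 1 ≤ P.m + P.K)
      (Λ'₀ : Finset (Fin P.d → ℤ)), HalfBox P.L (Mk P k) Λ'₀ → ∀ (Mc : ℕ), 5 ≤ Mc →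
      kR P.d P.d (gamma2153one P.d P.L) (cA P.d P.L (gamma2153one P.d P.L) c₀ δ₀) δ₀ < Mc →
      thetaConst P.d P.d (gamma2153one P.d P.L) (cA P.d P.L (gamma2153one P.d P.L) c₀ δ₀) δ₀ < Mc →
      thetaW P.d P.d (gamma2153one P.d P.L) (cA P.d P.L (gamma2153one P.d P.L) c₀ δ₀) δ₀ Mc < 1 → ∀ b b' : PBond P k,
      |(bondReductionLam P.L (Mk P k) Λ'₀ (reDelK (P.L ^ k) (one_le_Lpow P k) (Mk P k))).cov (idx P k b) (idx P k b')| ≤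
        (2 ^ P.d * (gamma2153one P.d P.L)⁻¹ *
              (1 - thetaW P.d P.d (gamma2153one P.d P.L) (cA P.d P.L (gamma2153one P.d P.L) c₀ δ₀) δ₀ Mc)⁻¹ * Real.exp (δ₀ / 4)) *
          Real.exp (2 * (δ₀ / 8 / Mc) * ((P.L : ℝ) - 1)) * ((P.L : ℝ) ^ P.d + 1) * ((P.L : ℝ) ^ P.d + 1) *
          Real.exp (-(δ₀ / 8 / Mc * (supDist b.src b'.src : ℝ))) := by
  obtain ⟨c₀, δ₀, hc, hδ, H⟩ := abs_cov_le_walk_DelK (d := d) (L := L) hd2 hL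
  refine ⟨c₀, δ₀, hc, hδ, fun P hPd hPL k hk Λ'₀ hbox Mc hM5 hMR hMθ hθW b b' => ?_⟩
  subst hPd hPL
  have h := H (Mk P k) (L_dvd_Mk hk) (P.L ^ k) (one_le_Lpow P k) Λ'₀ hbox Mc hM5 hMR hMθ hθW (idx P k b) (idx P k b')
  rwa [idx_fst_coe, idx_fst_coe, pdist_rep_eq_supDist] at h

end BIJ85

end

end Literature.MathematicalPhysics.QuantumFieldTheory.BalabanImbrieJaffe1984to88.BIJ88Eq249GaugeCovarianceTorus
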